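import Mathlib
import Summits.PneNP.PneNP.Theses.OverlapGapAlgebra
import Literature.Combinatorics.BinomialEntropyBound
import HarnessLib.Audit

/-!
# Line `DartGame` — skeleton for crux `OverlapGapAlgebra.NoStableSection` (stmt-PneNP-2462)

Route `route-PneNP-OverlapGapAlgebra`; crux idea card `binomial-extremal-dart-game` (ideator
cruxidea-stmt-PneNP-2462-1; its first lemma `dartGameSmallBall` is kernel-checked in
`Cruxes/NoStableSection/SketchIdeator1DartGame.lean`); lead prover-line-stmt-PneNP-2462-0,
PICKED.md 2026-08-16.

Crux (by name): `Summit.PneNP.PneNP.Theses.OverlapGapAlgebra.NoStableSection` — Bresler–Huang's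
ensemble multi-OGP for random k-SAT (arXiv:2106.02129 Thm 2.6 / Props 4.6–4.7 / §5) read for an
ARBITRARY section `g`: for k ≥ k₀ there are η, ν, c > 0 such that for all large n and every
`g : Inst → assignment`, the fraction of paths `Ψ` on which `g` is ν-valid at all `k·mk+1` splice
points and moves `≤ ηn` per step is `≤ e^{-cn}`.

## The line in one paragraph (COUNTING form of BH §4–5, uniform in `g`)

`StableValid g ⊆ IndepBad g ∪ OgpBad` by the deterministic ladder extraction (BH Prop 4.6) whose
Lipschitz input is the event's own `ηn`-stability through `|Δ condEnt| ≤ h₂(η)` (BH Lemma 4.8) —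
stubs `LadderExtraction` (abstract discrete IVT) and `EntropyToolkit`; `#IndepBad` is bounded by
ONE Fubini split over the literal coordinates of the typed product space (the instance one sweep
later reads coordinates disjoint from everything the earlier outputs read) times two g-free counts
(`#{y : condEnt ≤ b} ≤ (n+1)^{2^ℓ} e^{nb}`, stub `CondEntCount`; `#{Φ : y ν-valid} ≤
Σ_{j≤νm} C(m,j) (1-2^{-k})^{m-νm} #Φ`) — stub `IndepCount`; `#OgpBad` is the g-free first moment:
tuples counted rung by rung (`CondEntCount`, second clause), the path-correlated validity
probability of a fixed tuple bounded through interrupted slots and independent clause versions by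
`exp(-2^{-k} · D(Y) · #good slots)` (BH Lemma 5.3) — stub `PathValidCount` — and the energy
`D(Y) = E_I |{y^ℓ[I]}|` bounded below rung by rung by FIRST APPEARANCE + the binomial-extremality
small-ball bound of the card (replacing BH Props 5.5–5.7) — stub `EnergyBound`. The lead's stub
`Glue` assembles: window `[2.6, 2.7]·log k/k` (one bin; per-rung free-entropy margin → 0.59 at the
typed κ = 5), truncation `θ = 1/(k log² k)`, `η = 1/k²`, `ν = 4^{-k}`, every k-dependent inequality
as an `∀ᶠ k in atTop` statement, every n-dependent one as `∀ᶠ n`.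

## Shape

`NoStableSection_of : Registered.stub_ladderExtraction → … → Registered.stub_glue → NoStableSection`
concludes the crux BY NAME; `sorry` occurs only inside the six worker `stub_*` — the lead's `stub_glue` is PROVED in this file (parts 1–3c below). The vocabulary block
below is a verbatim copy of `Theorems/OverlapGapAlgebraNoStableSectionDefs.lean` (proposed; this
file switches to `import` once it lands) and is sorry-free.
-/

namespace Summit.PneNP.PneNP.Cruxes.NoStableSection.DartGame

set_option linter.unusedVariables false
set_option linter.dupNamespace false

-- BEGIN verbatim copy of Theorems/OverlapGapAlgebraNoStableSectionDefs.lean (drop when it lands)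

open Finset Real

/-! ## The typed path space -/

section Path

variable {k m n : ℕ}

/-- An instance: `m` clauses, each a `k`-tuple of literals `(variable, sign)`; literal `(v, b)` is
true under `σ` iff `σ v = b` (verbatim the crux's `Fin m → Fin k → Fin n × Bool`). -/
abbrev Inst (m k n : ℕ) : Type := Fin m → Fin k → Fin n × Bool

/-- The path space: `k + 1` independent uniform literal arrays `Ψ₀, …, Ψ_k` (the crux's `Ψ`). -/
abbrev PathSp (k m n : ℕ) : Type := Fin (k + 1) → Inst m k n

/-- The instance at splice point `(r, q)`: literal position `a·k + b` is read from `Ψ (r+1)` if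
`a·k + b < q` and from `Ψ r` otherwise (verbatim the `let P` of the crux; BH Def. 4.2). -/
def splice (Ψ : PathSp k m n) (r : Fin k) (q : ℕ) : Inst m k n :=
  fun a b => if (a : ℕ) * k + b < q then Ψ r.succ a b else Ψ r.castSucc a b

/-- At offset `q = 0` the instance of sweep `r` is `Ψ r`. -/
theorem splice_zero (Ψ : PathSp k m n) (r : Fin k) : splice Ψ r 0 = Ψ r.castSucc := by
  funext a b
  simp [splice]

/-- At offset `q = m * k` the instance of sweep `r` is `Ψ (r+1)` (the path is connected). -/
theorem splice_full (Ψ : PathSp k m n) (r : Fin k) : splice Ψ r (m * k) = Ψ r.succ := by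
  funext a b
  have ha := a.isLt
  have hb := b.isLt
  have h : (a : ℕ) * k + b < m * k := by
    calc (a : ℕ) * k + b < (a : ℕ) * k + k := by omega
      _ = ((a : ℕ) + 1) * k := by ring
      _ ≤ m * k := Nat.mul_le_mul_right k ha
  simp [splice, h]

/-- One splice step changes at most the literal at position `q`. -/
theorem splice_succ_of_ne (Ψ : PathSp k m n) (r : Fin k) (q : ℕ) (a : Fin m) (b : Fin k)
    (h : (a : ℕ) * k + b ≠ q) : splice Ψ r (q + 1) a b = splice Ψ r q a b := by
  unfold splice
  by_cases h1 : (a : ℕ) * k + b < q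
  · have h2 : (a : ℕ) * k + b < q + 1 := by omega
    simp [h1, h2]
  · have h2 : ¬ (a : ℕ) * k + b < q + 1 := by omega
    simp [h1, h2]

/-- The instance at linear time `t ∈ [0, k·(m k)]`: `t = r·(m k) + q` with `q < m k` is splice point
`(r, q)`, and the endpoint `t = k·(m k)` (and, as a junk value, every later `t`) is `Ψ k`. -/
def instAt (Ψ : PathSp k m n) (t : ℕ) : Inst m k n :=
  if h : t < k * (m * k) then
    splice Ψ ⟨t / (m * k), Nat.div_lt_of_lt_mul ((Nat.mul_comm k (m * k)) ▸ h)⟩ (t % (m * k))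
  else Ψ (Fin.last k)

/-- Unfolding `instAt` below the endpoint. -/
theorem instAt_of_lt (Ψ : PathSp k m n) {t : ℕ} (ht : t < k * (m * k)) (r : Fin k) (q : ℕ)
    (hr : t / (m * k) = r) (hq : t % (m * k) = q) : instAt Ψ t = splice Ψ r q := by
  unfold instAt
  rw [dif_pos ht]
  congr 1
  exact Fin.ext hr

/-- Unfolding `instAt` at (and beyond) the endpoint. -/
theorem instAt_of_le (Ψ : PathSp k m n) {t : ℕ} (ht : k * (m * k) ≤ t) :
    instAt Ψ t = Ψ (Fin.last k) := by
  unfold instAt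
  rw [dif_neg (Nat.not_lt.2 ht)]

/-- `instAt` at time `r·(m k) + q`, `q ≤ m k`, is the splice point `(r, q)` (at `q = m k` this is
the connectedness of the path across sweeps). -/
theorem instAt_eq_splice (Ψ : PathSp k m n) (r : Fin k) {q : ℕ} (hq : q ≤ m * k) :
    instAt Ψ ((r : ℕ) * (m * k) + q) = splice Ψ r q := by
  have hr := r.isLt
  -- degenerate case `m = 0`: instances form a subsingleton
  rcases Nat.eq_zero_or_pos m with rfl | hm
  · funext a; exact a.elim0
  have hW : 0 < m * k := Nat.mul_pos hm (by omega)
  rcases lt_or_eq_of_le hq with hlt | rfl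
  · have ht : (r : ℕ) * (m * k) + q < k * (m * k) := by
      calc (r : ℕ) * (m * k) + q < (r : ℕ) * (m * k) + m * k := by omega
        _ = ((r : ℕ) + 1) * (m * k) := by ring
        _ ≤ k * (m * k) := Nat.mul_le_mul_right _ hr
    refine instAt_of_lt Ψ ht r q ?_ ?_
    · rw [Nat.mul_comm, Nat.mul_add_div hW, Nat.div_eq_of_lt hlt, Nat.add_zero]
    · rw [Nat.mul_comm, Nat.mul_add_mod, Nat.mod_eq_of_lt hlt]
  · -- `q = m * k`: the endpoint of sweep `r` is `Ψ (r+1)`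
    rw [splice_full]
    by_cases hlast : (r : ℕ) + 1 < k
    · have ht : (r : ℕ) * (m * k) + m * k < k * (m * k) := by
        calc (r : ℕ) * (m * k) + m * k = ((r : ℕ) + 1) * (m * k) := by ring
          _ < k * (m * k) := Nat.mul_lt_mul_of_pos_right hlast hW
      rw [instAt_of_lt Ψ ht ⟨r + 1, hlast⟩ 0, splice_zero]
      · rfl
      · rw [show (r : ℕ) * (m * k) + m * k = ((r : ℕ) + 1) * (m * k) by ring,
          Nat.mul_div_cancel _ hW]
      · rw [show (r : ℕ) * (m * k) + m * k = ((r : ℕ) + 1) * (m * k) by ring, Nat.mul_mod_left]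
    · have hrk : (r : ℕ) + 1 = k := by omega
      rw [instAt_of_le Ψ (by
        rw [show (r : ℕ) * (m * k) + m * k = ((r : ℕ) + 1) * (m * k) by ring, hrk])]
      congr 1
      exact Fin.ext (by simp [hrk])

/-- Number of clauses of `Φ` violated by the assignment `σ` (a clause is violated iff all its
literals are false, literal `(v, b)` being true iff `σ v = b`). -/
def violCount (σ : Fin n → Bool) (Φ : Inst m k n) : ℕ :=
  (univ.filter fun i : Fin m => ∀ j, σ (Φ i j).1 ≠ (Φ i j).2).card

end Path

/-! ## Empirical (type) entropies of a sequence of assignments -/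

section Entropy

variable {n : ℕ}

/-- Number of positions `i` whose column over the first `ℓ` rungs is the pattern `ξ`. -/
def patCount (Y : ℕ → Fin n → Bool) (ℓ : ℕ) (ξ : Fin ℓ → Bool) : ℕ :=
  (univ.filter fun i : Fin n => (fun j : Fin ℓ => Y j i) = ξ).card

/-- Empirical entropy (nats) of the column patterns of the first `ℓ` rungs:
`H_ℓ(Y) = Σ_ξ η(N_ℓ(ξ)/n)`, `η = Real.negMulLog`. -/
noncomputable def typeEnt (Y : ℕ → Fin n → Bool) (ℓ : ℕ) : ℝ :=
  ∑ ξ : Fin ℓ → Bool, negMulLog ((patCount Y ℓ ξ : ℝ) / n)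

/-- Conditional (type) entropy of rung `ℓ` given rungs `0, …, ℓ-1`: `H_{ℓ+1} - H_ℓ`. -/
noncomputable def condEnt (Y : ℕ → Fin n → Bool) (ℓ : ℕ) : ℝ :=
  typeEnt Y (ℓ + 1) - typeEnt Y ℓ

/-- The sequence `R` with the candidate `v` inserted as rung `ℓ` (and all later rungs). -/
def withRung (R : ℕ → Fin n → Bool) (ℓ : ℕ) (v : Fin n → Bool) : ℕ → Fin n → Bool :=
  fun j => if j < ℓ then R j else v

/-- A finite tuple of assignments as a sequence (junk value `false` beyond its length). -/
def seqOf {L : ℕ} (Y : Fin L → Fin n → Bool) : ℕ → Fin n → Bool :=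
  fun j => if h : j < L then Y ⟨j, h⟩ else fun _ => false

/-- `seqOf` below the length. -/
theorem seqOf_apply_lt {L : ℕ} (Y : Fin L → Fin n → Bool) {j : ℕ} (h : j < L) :
    seqOf Y j = Y ⟨j, h⟩ := by
  simp [seqOf, h]

/-- `seqOf` at an index of the tuple. -/
@[simp] theorem seqOf_apply_fin {L : ℕ} (Y : Fin L → Fin n → Bool) (j : Fin L) :
    seqOf Y j = Y j := by
  simp [seqOf, j.isLt]

/-- `withRung` below the insertion point reads the prefix. -/
theorem withRung_of_lt (R : ℕ → Fin n → Bool) (ℓ : ℕ) (v : Fin n → Bool) {j : ℕ} (h : j < ℓ) :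
    withRung R ℓ v j = R j := by
  simp [withRung, h]

/-- `withRung` at and beyond the insertion point reads the candidate. -/
theorem withRung_of_le (R : ℕ → Fin n → Bool) (ℓ : ℕ) (v : Fin n → Bool) {j : ℕ} (h : ℓ ≤ j) :
    withRung R ℓ v j = v := by
  simp [withRung, Nat.not_lt.2 h]

/-- `withRung` at the insertion point is the candidate. -/
@[simp] theorem withRung_self (R : ℕ → Fin n → Bool) (ℓ : ℕ) (v : Fin n → Bool) :
    withRung R ℓ v ℓ = v :=
  withRung_of_le R ℓ v le_rfl

/-- `withRung R ℓ v` only reads `R` below `ℓ`. -/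
theorem withRung_congr {R R' : ℕ → Fin n → Bool} {ℓ : ℕ} (h : ∀ j < ℓ, R j = R' j)
    (v : Fin n → Bool) : withRung R ℓ v = withRung R' ℓ v := by
  funext j
  by_cases hj : j < ℓ
  · simp [withRung, hj, h j hj]
  · simp [withRung, hj]

/-- `patCount Y ℓ` only reads rungs `< ℓ`. -/
theorem patCount_congr {Y Y' : ℕ → Fin n → Bool} {ℓ : ℕ} (h : ∀ j < ℓ, Y j = Y' j)
    (ξ : Fin ℓ → Bool) : patCount Y ℓ ξ = patCount Y' ℓ ξ := by
  unfold patCount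
  congr 1
  ext i
  simp only [mem_filter, mem_univ, true_and]
  have : (fun j : Fin ℓ => Y j i) = fun j : Fin ℓ => Y' j i := by
    funext j; rw [h j j.isLt]
  rw [this]

/-- `typeEnt Y ℓ` only reads rungs `< ℓ`. -/
theorem typeEnt_congr {Y Y' : ℕ → Fin n → Bool} {ℓ : ℕ} (h : ∀ j < ℓ, Y j = Y' j) :
    typeEnt Y ℓ = typeEnt Y' ℓ := by
  unfold typeEnt
  exact sum_congr rfl fun ξ _ => by rw [patCount_congr h]

/-- `condEnt Y ℓ` only reads rungs `≤ ℓ`. -/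
theorem condEnt_congr {Y Y' : ℕ → Fin n → Bool} {ℓ : ℕ} (h : ∀ j ≤ ℓ, Y j = Y' j) :
    condEnt Y ℓ = condEnt Y' ℓ := by
  unfold condEnt
  rw [typeEnt_congr (fun j hj => h j (by omega)), typeEnt_congr (fun j hj => h j (by omega))]

/-- The potential of the ladder argument is local in the prefix. -/
theorem condEnt_withRung_congr {R R' : ℕ → Fin n → Bool} {ℓ : ℕ} (h : ∀ j < ℓ, R j = R' j)
    (v : Fin n → Bool) : condEnt (withRung R ℓ v) ℓ = condEnt (withRung R' ℓ v) ℓ := by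
  rw [withRung_congr h]

/-- The pattern classes partition the positions: `Σ_ξ N_ℓ(ξ) = n`. -/
theorem sum_patCount (Y : ℕ → Fin n → Bool) (ℓ : ℕ) : ∑ ξ : Fin ℓ → Bool, patCount Y ℓ ξ = n := by
  unfold patCount
  rw [← card_eq_sum_card_fiberwise (f := fun i : Fin n => fun j : Fin ℓ => Y j i) (s := univ)
    (t := univ) (fun _ _ => mem_univ _)]
  simp

/-- Refining a pattern class by the value of rung `ℓ`: `N_ℓ(ξ) = N_{ℓ+1}(ξ·true) + N_{ℓ+1}(ξ·false)`
(patterns of length `ℓ+1` written as `Fin.snoc ξ b`). -/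
theorem patCount_succ_eq (Y : ℕ → Fin n → Bool) (ℓ : ℕ) (ξ : Fin ℓ → Bool) :
    patCount Y ℓ ξ = patCount Y (ℓ + 1) (Fin.snoc ξ true) + patCount Y (ℓ + 1) (Fin.snoc ξ false) := by
  unfold patCount
  rw [← card_union_of_disjoint]
  · congr 1
    ext i
    simp only [mem_filter, mem_univ, true_and, mem_union]
    constructor
    · intro h
      cases hb : Y ℓ i
      · right
        funext j
        refine Fin.lastCases ?_ (fun j => ?_) j
        · simp [hb]
        · simpa using congrFun h j
      · left
        funext j
        refine Fin.lastCases ?_ (fun j => ?_) j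
        · simp [hb]
        · simpa using congrFun h j
    · rintro (h | h)
      · funext j
        have := congrFun h (Fin.castSucc j)
        simpa using this
      · funext j
        have := congrFun h (Fin.castSucc j)
        simpa using this
  · rw [disjoint_filter]
    intro i _ h1 h2
    have h1' := congrFun h1 (Fin.last ℓ)
    have h2' := congrFun h2 (Fin.last ℓ)
    simp only [Fin.snoc_last] at h1' h2'
    rw [h1'] at h2'
    exact Bool.noConfusion h2'

/-- Every position carries the empty pattern: `N_0(ξ) = n`. -/
theorem patCount_zero (Y : ℕ → Fin n → Bool) (ξ : Fin 0 → Bool) : patCount Y 0 ξ = n := by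
  unfold patCount
  rw [filter_true_of_mem (fun i _ => Subsingleton.elim _ _)]
  simp

/-- `H_0 = 0` (one empty pattern, carried by all `n` positions). -/
theorem typeEnt_zero (Y : ℕ → Fin n → Bool) : typeEnt Y 0 = 0 := by
  unfold typeEnt
  simp only [patCount_zero]
  rcases Nat.eq_zero_or_pos n with rfl | hn
  · simp [negMulLog]
  · rw [div_self (by exact_mod_cast hn.ne')]
    simp [negMulLog]

/-- The sum over patterns of length `ℓ + 1` as a sum over (pattern of length `ℓ`, last bit). -/
theorem sum_pattern_succ {M : Type*} [AddCommMonoid M] (ℓ : ℕ) (f : (Fin (ℓ + 1) → Bool) → M) :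
    ∑ ξ' : Fin (ℓ + 1) → Bool, f ξ' =
      ∑ ξ : Fin ℓ → Bool, (f (Fin.snoc ξ true) + f (Fin.snoc ξ false)) := by
  rw [← (Fin.snocEquiv fun _ : Fin (ℓ + 1) => Bool).sum_comp, Fintype.sum_prod_type,
    Fintype.sum_bool, ← sum_add_distrib]
  rfl

/-- **Conditional form** of the conditional type entropy (BH Fact 4.5, chain rule, read backwards):
`condEnt Y ℓ = Σ_ξ (N_ℓ(ξ)/n) · h₂(N_{ℓ+1}(ξ·true)/N_ℓ(ξ))` with `h₂ = Real.binEntropy` (a class with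
`N_ℓ(ξ) = 0` contributes `0`). -/
theorem condEnt_eq_sum_binEntropy (Y : ℕ → Fin n → Bool) (ℓ : ℕ) :
    condEnt Y ℓ = ∑ ξ : Fin ℓ → Bool, ((patCount Y ℓ ξ : ℝ) / n) *
      binEntropy ((patCount Y (ℓ + 1) (Fin.snoc ξ true) : ℝ) / patCount Y ℓ ξ) := by
  unfold condEnt typeEnt
  rw [sum_pattern_succ, ← sum_sub_distrib]
  refine sum_congr rfl fun ξ _ => ?_
  -- abbreviations: `N = A + B`
  have hN := patCount_succ_eq Y ℓ ξ
  set N : ℕ := patCount Y ℓ ξ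
  set A : ℕ := patCount Y (ℓ + 1) (Fin.snoc ξ true)
  set B : ℕ := patCount Y (ℓ + 1) (Fin.snoc ξ false)
  rcases Nat.eq_zero_or_pos N with hN0 | hNpos
  · have hA : A = 0 := by omega
    have hB : B = 0 := by omega
    simp [hN0, hA, hB, negMulLog]
  · have hNr : (0 : ℝ) < N := by exact_mod_cast hNpos
    set lam : ℝ := (A : ℝ) / N with hlam
    have hA' : (A : ℝ) / n = lam * ((N : ℝ) / n) := by
      rw [hlam]; field_simp
    have hB' : (B : ℝ) / n = (1 - lam) * ((N : ℝ) / n) := by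
      have : (B : ℝ) = N - A := by
        have : (N : ℝ) = A + B := by exact_mod_cast hN
        linarith
      rw [this, hlam]
      field_simp
    rw [hA', hB', negMulLog_mul, negMulLog_mul, binEntropy_eq_negMulLog_add_negMulLog_one_sub]
    ring

/-- Conditional type entropies are nonnegative. -/
theorem condEnt_nonneg (Y : ℕ → Fin n → Bool) (ℓ : ℕ) : 0 ≤ condEnt Y ℓ := by
  rw [condEnt_eq_sum_binEntropy]
  refine sum_nonneg fun ξ _ => mul_nonneg (by positivity) (binEntropy_nonneg (by positivity) ?_)
  rcases Nat.eq_zero_or_pos (patCount Y ℓ ξ) with h0 | hpos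
  · simp [h0]
  · rw [div_le_one (by exact_mod_cast hpos)]
    exact_mod_cast (by rw [patCount_succ_eq Y ℓ ξ]; omega :
      patCount Y (ℓ + 1) (Fin.snoc ξ true) ≤ patCount Y ℓ ξ)

end Entropy

/-! ## The energy functional -/

section Energy

variable {n : ℕ}

/-- The set of patterns `{(Y ℓ ∘ I) : ℓ ≤ k}` read by the variable tuple `I`. -/
def patternsAt (Y : ℕ → Fin n → Bool) (k : ℕ) (I : Fin k → Fin n) : Finset (Fin k → Bool) :=
  univ.image fun ℓ : Fin (k + 1) => fun r => Y ℓ (I r)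

/-- `energySum Y k = Σ_{I : Fin k → Fin n} |{(Y ℓ ∘ I) : ℓ ≤ k}|`, i.e. `n^k · E_I |{y^ℓ[I] : ℓ ≤ k}|`
(the energy term of BH Lemma 5.1 / Prop. 5.2 before normalisation). -/
def energySum (Y : ℕ → Fin n → Bool) (k : ℕ) : ℕ :=
  ∑ I : Fin k → Fin n, (patternsAt Y k I).card

end Energy

/-! ## The three events -/

section Events

variable {k m n : ℕ}

/-- The crux's event for the section `g`: `ν`-valid at every splice point and `η n`-stable between
consecutive ones (syntactically the filter predicate of `NoStableSection` with `P = splice Ψ`). -/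
def StableValid (g : Inst m k n → (Fin n → Bool)) (η ν : ℝ) (Ψ : PathSp k m n) : Prop :=
  (∀ r : Fin k, ∀ q ≤ m * k,
      ((univ.filter fun i : Fin m => ∀ j, g (splice Ψ r q) (splice Ψ r q i j).1 ≠
        (splice Ψ r q i j).2).card : ℝ) ≤ ν * m) ∧
    ∀ r : Fin k, ∀ q < m * k, (hammingDist (g (splice Ψ r q)) (g (splice Ψ r (q + 1))) : ℝ) ≤ η * n

/-- Complement of BH's `S_indep` for the section `g` (slightly enlarged): some instance at a time
`t₀ ≤ k·(m k)` has a `ν`-valid assignment `y` of conditional type entropy `≤ bp` relative to the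
outputs of `g` at `ℓ ≤ k` earlier times, each at least one full sweep (`m k` steps) before `t₀`. -/
def IndepBad (g : Inst m k n → (Fin n → Bool)) (ν bp : ℝ) (Ψ : PathSp k m n) : Prop :=
  ∃ ℓ : Fin (k + 1), ∃ t₀ : ℕ, ∃ ts : Fin ℓ → ℕ, ∃ y : Fin n → Bool,
    t₀ ≤ k * (m * k) ∧ (∀ j, ts j + m * k ≤ t₀) ∧
    (violCount y (instAt Ψ t₀) : ℝ) ≤ ν * m ∧
    condEnt (withRung (seqOf fun j : Fin ℓ => g (instAt Ψ (ts j))) ℓ y) ℓ ≤ bp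

/-- Complement of BH's `S_ogp` (the forbidden ladder): times `t₀ ≤ … ≤ t_k ≤ k·(m k)` and assignments
`y⁰, …, y^k`, each `ν`-valid for the instance at its time, every rung `ℓ ≥ 1` of conditional type
entropy in `[bm, bp]` given its predecessors. -/
def OgpBad (k m n : ℕ) (ν bm bp : ℝ) (Ψ : PathSp k m n) : Prop :=
  ∃ ts : Fin (k + 1) → ℕ, ∃ Y : Fin (k + 1) → (Fin n → Bool),
    Monotone ts ∧ ts (Fin.last k) ≤ k * (m * k) ∧
    (∀ ℓ, (violCount (Y ℓ) (instAt Ψ (ts ℓ)) : ℝ) ≤ ν * m) ∧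
    ∀ ℓ : Fin (k + 1), 1 ≤ (ℓ : ℕ) → condEnt (seqOf Y) ℓ ∈ Set.Icc bm bp

end Events

-- END verbatim copy of Theorems/OverlapGapAlgebraNoStableSectionDefs.lean

/-! ## The seven stub statements -/

/-- **Stub A — abstract ladder extraction** (BH Prop. 4.6 with Lemma 4.8 folded into the Lipschitz
hypothesis; pure finite combinatorics, a discrete intermediate-value argument by recursion on the
rung index). A potential `h R ℓ v` ("conditional entropy of the candidate `v` given the first `ℓ`
rungs of `R`") that is local in the prefix, vanishes on repeated points, moves by `≤ δ ≤ bp - bm`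
per path step, and exceeds `bp` at any time at least one window `W` after all earlier rungs,
admits `k` successive rungs inside `[bm, bp]`, each at most `W` steps after the previous one. -/
def LadderExtraction : Prop :=
  ∀ (V : Type) (k W : ℕ) (x : ℕ → V) (h : (ℕ → V) → ℕ → V → ℝ) (δ bm bp : ℝ),
    0 < W → 0 ≤ bm → δ ≤ bp - bm →
    (∀ (R R' : ℕ → V) (ℓ : ℕ) (v : V), (∀ j < ℓ, R j = R' j) → h R ℓ v = h R' ℓ v) →
    (∀ (R : ℕ → V) (ℓ : ℕ) (v : V), (∃ j < ℓ, R j = v) → h R ℓ v = 0) →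
    (∀ (R : ℕ → V) (ℓ t : ℕ), t < k * W → |h R ℓ (x (t + 1)) - h R ℓ (x t)| ≤ δ) →
    (∀ (ℓ : ℕ) (ts : ℕ → ℕ) (t : ℕ), 1 ≤ ℓ → ℓ ≤ k → (∀ j < ℓ, ts j + W ≤ t) → t ≤ k * W →
        bp < h (fun j => x (ts j)) ℓ (x t)) →
    ∃ ts : ℕ → ℕ, ts 0 = 0 ∧ (∀ ℓ < k, ts ℓ < ts (ℓ + 1) ∧ ts (ℓ + 1) ≤ ts ℓ + W) ∧
      ∀ ℓ, 1 ≤ ℓ → ℓ ≤ k → h (fun j => x (ts j)) ℓ (x (ts ℓ)) ∈ Set.Icc bm bp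

/-- **Stub B — entropy toolkit** (BH Fact 4.5 (iii) and Lemma 4.8 for the ordered conditional type
entropy): the potential vanishes on a repeated rung, and is `h₂(Δ/n)`-Lipschitz in the candidate
for Hamming distance `Δ ≤ n/2` (subadditivity + Jensen for the concave `Real.binEntropy`, via the
conditional form `condEnt_eq_sum_binEntropy`). -/
def EntropyToolkit : Prop :=
  (∀ (n ℓ : ℕ) (R : ℕ → Fin n → Bool) (v : Fin n → Bool),
      (∃ j < ℓ, R j = v) → condEnt (withRung R ℓ v) ℓ = 0) ∧
  (∀ (n ℓ : ℕ) (R : ℕ → Fin n → Bool) (v v' : Fin n → Bool),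
      (hammingDist v v' : ℝ) ≤ n / 2 →
      |condEnt (withRung R ℓ v) ℓ - condEnt (withRung R ℓ v') ℓ| ≤
        Real.binEntropy ((hammingDist v v' : ℝ) / n))

/-- **Stub C — counting by conditional type entropy** (method of types, BH §4.6 / Lemma 5.1 with
`2^n·binom ≤ exp(n H)` EXACT): (1) for a fixed prefix, the candidates of conditional entropy `≤ b`
number at most `(n+1)^{2^ℓ} e^{nb}` (classify by the refined count vector, `Π_ξ C(N_ξ, c_ξ) ≤
exp(Σ N_ξ h₂(c_ξ/N_ξ))` by `choose_le_exp_spinRate`); (2) iterating over the rungs, the tuples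
`(y⁰,…,y^L)` all of whose rungs `ℓ ≥ 1` have conditional entropy `≤ b` number at most
`2^n ((n+1)^{2^L} e^{nb})^L`. -/
def CondEntCount : Prop :=
  (∀ (n ℓ : ℕ) (R : ℕ → Fin n → Bool) (b : ℝ),
      ((Finset.univ.filter fun v : Fin n → Bool => condEnt (withRung R ℓ v) ℓ ≤ b).card : ℝ) ≤
        ((n : ℝ) + 1) ^ (2 ^ ℓ) * Real.exp (n * b)) ∧
  (∀ (n L : ℕ) (b : ℝ), 0 ≤ b →
      ((Finset.univ.filter fun Y : Fin (L + 1) → (Fin n → Bool) =>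
          ∀ ℓ : Fin (L + 1), 1 ≤ (ℓ : ℕ) → condEnt (seqOf Y) ℓ ≤ b).card : ℝ) ≤
        (2 : ℝ) ^ n * (((n : ℝ) + 1) ^ (2 ^ L) * Real.exp (n * b)) ^ L)

/-- **Stub E — validity along the path for a fixed ladder** (BH Lemma 5.3 in counting form, no
asymptotics): for fixed times and assignments, the paths on which every `Y ℓ` violates at most `J`
clauses of the instance at time `ts ℓ` are a fraction at most
`Σ_{j ≤ (k+1)J} C(m,j) · exp(-2^{-k} · D(Y) · (m - (k+1)J - (k+1)))`, `D(Y) = energySum/n^k`: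
throw out the `≤ (k+1)J` bad and `≤ k+1` interrupted clause slots; a good slot's `k+1` versions
split into independent uniform clauses `C_s = Ψ s a` (source `s_ℓ(a) = r_ℓ + [a·k+k ≤ q_ℓ]`), the
slot is a product set of the path space (`Fintype.card_piFinset`), and
`#{C : no ℓ ∈ B falsifies C} = (2n)^k - Σ_v |{Y ℓ ∘ v : ℓ ∈ B}| ≤ (2n)^k exp(-2^{-k} x_B)` with
`Σ_s x_{B_s} ≥ D(Y)` (images of a union). -/
def PathValidCount : Prop :=
  ∀ (k m n : ℕ) (ts : Fin (k + 1) → ℕ) (Y : Fin (k + 1) → Fin n → Bool) (J : ℕ),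
    1 ≤ n → (∀ ℓ, ts ℓ ≤ k * (m * k)) →
    ((Finset.univ.filter fun Ψ : PathSp k m n =>
        ∀ ℓ, violCount (Y ℓ) (instAt Ψ (ts ℓ)) ≤ J).card : ℝ) ≤
      (∑ j ∈ Finset.range ((k + 1) * J + 1), (m.choose j : ℝ)) *
        Real.exp (-((1 / 2 : ℝ) ^ k * ((energySum (seqOf Y) k : ℝ) / (n : ℝ) ^ k) *
          ((m : ℝ) - (k + 1) * J - (k + 1)))) *
        Fintype.card (PathSp k m n)

/-- **Stub F — the one Fubini split** (BH Prop. 4.7 (ii), the single place where "`x^t` is a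
function of `Φ^t`" enters): for a fixed section `g`, a time `t₀` and earlier times `ts j ≤ t₀ - mk`,
the instance `instAt Ψ t₀` reads literal coordinates of `Ψ` disjoint from all coordinates read by
the `instAt Ψ (ts j)` (hence by the earlier outputs), so the paths carrying a `J`-valid `y` of
conditional entropy `≤ b` relative to the earlier outputs are a fraction at most
`Bc · Σ_{j≤J} C(m,j) · (1-2^{-k})^{m-J}`, where `Bc` bounds the candidate count for EVERY prefix
(supplied by Stub C) and the last two factors bound `#{Φ : violCount y Φ ≤ J}/#Φ` for each fixed
`y` (a product count over clauses: a uniform clause is falsified by `y` with probability `2^{-k}`). -/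
def IndepCount : Prop :=
  ∀ (k m n : ℕ) (g : Inst m k n → Fin n → Bool) (ℓ t₀ : ℕ) (ts : Fin ℓ → ℕ) (J : ℕ) (b Bc : ℝ),
    1 ≤ n → t₀ ≤ k * (m * k) → (∀ j, ts j + m * k ≤ t₀) →
    (∀ R : ℕ → Fin n → Bool,
      ((Finset.univ.filter fun y : Fin n → Bool => condEnt (withRung R ℓ y) ℓ ≤ b).card : ℝ) ≤
        Bc) →
    ((Finset.univ.filter fun Ψ : PathSp k m n => ∃ y : Fin n → Bool,
        violCount y (instAt Ψ t₀) ≤ J ∧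
        condEnt (withRung (seqOf fun j : Fin ℓ => g (instAt Ψ (ts j))) ℓ y) ℓ ≤ b).card : ℝ) ≤
      Bc * (∑ j ∈ Finset.range (J + 1), (m.choose j : ℝ)) * (1 - (1 / 2 : ℝ) ^ k) ^ (m - J) *
        Fintype.card (PathSp k m n)

/-- **Stub En — the energy bound** (BH Prop. 5.2 replaced by FIRST APPEARANCE + the card's
binomial-extremality small ball): `E_I |{y^ℓ[I] : ℓ ≤ k}| = 1 + Σ_{ℓ=1}^k P_I[y^ℓ[I] new]`;
conditionally on the revealed patterns the bits `y^ℓ[I]_r` are independent with laws `φ(·|ξ_r)`,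
so `P[new_ℓ] ≥ P[Π_r φ(b_r|ξ_r) ≤ θ] - ℓθ ≥ 1 - P[Σ_r X_r < 1] - ℓθ` with
`X = min(-log φ, -log θ)/(-log θ) ∈ [0,1]` of mean `p ≥ (condEnt - 2θ)/(-log θ) ≥ p₀`
(`E[u] = condEnt` by the conditional form; `E(u-L)⁺ ≤ 2θ` by `log x ≤ x - 1`), and
`P[Σ X < 1] ≤ 2(1-p)^k + kp(1-p)^{k-1}` (`dartGameSmallBall`, antitone in `p`). -/
def EnergyBound : Prop :=
  ∀ (n k : ℕ) (Y : ℕ → Fin n → Bool) (θ b p₀ : ℝ), 1 ≤ n → 1 ≤ k → 0 < θ → θ < 1 →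
    2 * θ ≤ b → p₀ = (b - 2 * θ) / (-Real.log θ) →
    (∀ ℓ, 1 ≤ ℓ → ℓ ≤ k → b ≤ condEnt Y ℓ) →
    (1 : ℝ) + k * (1 - (2 * (1 - p₀) ^ k + k * p₀ * (1 - p₀) ^ (k - 1))) -
        θ * ((k : ℝ) * (k + 1) / 2) ≤ (energySum Y k : ℝ) / (n : ℝ) ^ k

/-- **Stub G — the glue** (lead): parameters `bm = 2.6 log k/k`, `bp = 2.7 log k/k`, `η = 1/k²`,
`ν = 4^{-k}`, `θ = 1/(k log² k)`; `StableValid ⊆ IndepBad ∪ OgpBad` (Stubs A, B via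
`instAt_eq_splice`); union bounds over `≤ (T+1)^{k+2}` time tuples; the two exponents
`2.7 - 5(1-ν) + 5·2^k h₂(ν) < 0` and `log 2 + log k·[2.7 - 5(1-SB_k)(1-(k+1)ν)] + O(1/log k) < 0`
eventually in `k` (limits `SB_k → 4.6 e^{-2.6} = 0.3417`); polynomial factors absorbed eventually
in `n`; the count rewritten as the crux's filter (`StableValid` is its predicate with `P = splice`). -/
def Glue : Prop :=
  LadderExtraction → EntropyToolkit → CondEntCount → PathValidCount → IndepCount → EnergyBound →
    Summit.PneNP.PneNP.Theses.OverlapGapAlgebra.NoStableSection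

/-! ## The stubs -/

/-- Stub A (worker). Size S/M. Leans on: nothing beyond Mathlib (`Nat.find`). -/
theorem stub_ladderExtraction : LadderExtraction := by
  sorry

/-- Stub B (worker). Size M. Leans on: `condEnt_eq_sum_binEntropy`, `patCount_succ_eq`,
`Real.strictConcave_binEntropy`, `Real.binEntropy_strictMonoOn`, `ConcaveOn.le_map_sum`. -/
theorem stub_entropyToolkit : EntropyToolkit := by
  sorry

/-- Stub C (worker). Size M. Leans on: `condEnt_eq_sum_binEntropy`,
`Literature.Probability.LatticeModels.choose_le_exp_spinRate` +
`spinRate_eq_log_two_sub_binEntropy` (or a direct proof of `C(N,j) ≤ exp(N h₂(j/N))`),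
`Finset.card_le_card_of_injOn`, `Finset.card_powersetCard`. -/
theorem stub_condEntCount : CondEntCount := by
  sorry

/-- Stub E (worker). Size L. Leans on: `instAt_eq_splice`, `splice`, `Fintype.card_piFinset`,
`Finset.card_image_le`, `Real.add_one_le_exp`. -/
theorem stub_pathValidCount : PathValidCount := by
  sorry

/-- Stub F (worker). Size L. Leans on: `instAt_eq_splice`, `Equiv.piEquivPiSubtypeProd`,
`Fintype.card_piFinset`, `Finset.card_eq_sum_card_fiberwise`. -/
theorem stub_indepCount : IndepCount := by
  sorry

/-- Stub En (worker). Size L. Leans on: `dartGameSmallBall` (to be landed under Theorems from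
`Cruxes/NoStableSection/SketchIdeator1DartGame.lean`), `condEnt_eq_sum_binEntropy`,
`Fintype.card_piFinset`, `Real.log_le_sub_one_of_pos`. -/
theorem stub_energyBound : EnergyBound := by
  sorry

/-! ## Glue, part 1: the decomposition `StableValid ⊆ IndepBad ∪ OgpBad` (BH Prop. 4.6) -/

section Decomposition

variable {k m n : ℕ}

/-- Every time `t ≤ k·(m k)` is a splice point `(r, q)` with `q ≤ m k` (for `k ≥ 1`). -/
theorem glue_exists_splice (hk : 1 ≤ k) {t : ℕ} (ht : t ≤ k * (m * k)) :
    ∃ r : Fin k, ∃ q : ℕ, q ≤ m * k ∧ t = (r : ℕ) * (m * k) + q := by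
  rcases Nat.eq_zero_or_pos (m * k) with hW | hW
  · refine ⟨⟨0, hk⟩, 0, Nat.zero_le _, ?_⟩
    rw [hW, Nat.mul_zero] at ht
    simp [hW, Nat.le_zero.1 ht]
  rcases lt_or_eq_of_le ht with hlt | rfl
  · refine ⟨⟨t / (m * k), Nat.div_lt_of_lt_mul ((Nat.mul_comm k (m * k)) ▸ hlt)⟩, t % (m * k),
      (Nat.mod_lt _ hW).le, ?_⟩
    simp only
    rw [Nat.mul_comm, Nat.div_add_mod]
  · refine ⟨⟨k - 1, by omega⟩, m * k, le_rfl, ?_⟩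
    simp only
    rw [show (k - 1) * (m * k) + m * k = (k - 1 + 1) * (m * k) by ring, Nat.sub_add_cancel hk]

/-- On the crux's event, `g` is `ν`-valid at every linear time `t ≤ k·(m k)`. -/
theorem glue_viol_instAt {g : Inst m k n → Fin n → Bool} {η ν : ℝ} {Ψ : PathSp k m n}
    (h : StableValid g η ν Ψ) (hk : 1 ≤ k) {t : ℕ} (ht : t ≤ k * (m * k)) :
    (violCount (g (instAt Ψ t)) (instAt Ψ t) : ℝ) ≤ ν * m := by
  obtain ⟨r, q, hq, rfl⟩ := glue_exists_splice hk ht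
  rw [instAt_eq_splice Ψ r hq]
  exact h.1 r q hq

/-- On the crux's event, consecutive outputs along linear time move by `≤ η n`. -/
theorem glue_dist_instAt_succ {g : Inst m k n → Fin n → Bool} {η ν : ℝ} {Ψ : PathSp k m n}
    (h : StableValid g η ν Ψ) {t : ℕ} (ht : t < k * (m * k)) :
    (hammingDist (g (instAt Ψ t)) (g (instAt Ψ (t + 1))) : ℝ) ≤ η * n := by
  have hW : 0 < m * k := Nat.pos_of_ne_zero fun h0 => by rw [h0, Nat.mul_zero] at ht; omega
  set r : ℕ := t / (m * k) with hr
  set q : ℕ := t % (m * k) with hq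
  have hrk : r < k := Nat.div_lt_of_lt_mul ((Nat.mul_comm k (m * k)) ▸ ht)
  have hqW : q < m * k := Nat.mod_lt _ hW
  have ht' : t = ((⟨r, hrk⟩ : Fin k) : ℕ) * (m * k) + q := by
    simp only; rw [hr, hq, Nat.mul_comm, Nat.div_add_mod]
  have h1 : instAt Ψ t = splice Ψ ⟨r, hrk⟩ q := by
    rw [ht']; exact instAt_eq_splice Ψ _ hqW.le
  have h2 : instAt Ψ (t + 1) = splice Ψ ⟨r, hrk⟩ (q + 1) := by
    rw [ht', add_assoc]; exact instAt_eq_splice Ψ _ hqW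
  rw [h1, h2]
  exact h.2 ⟨r, hrk⟩ q hqW

/-- **The decomposition** (BH Prop. 4.6 for an arbitrary section): on the crux's event and on
`S_indep`, the outputs of `g` along the path contain a forbidden ladder. Uses Stub A (extraction)
with the potential `h R ℓ v = condEnt (withRung R ℓ v) ℓ`, Stub B (zero on repeats; Lipschitz step
`≤ h₂(η) ≤ bp - bm`). -/
theorem glue_ogpBad_of_stableValid (hA : LadderExtraction) (hB : EntropyToolkit) (hk : 1 ≤ k)
    (hW : 0 < m * k) {η ν bm bp : ℝ} (hη : 0 ≤ η) (hη2 : η ≤ 1 / 2) (hbm : 0 ≤ bm)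
    (hwin : Real.binEntropy η ≤ bp - bm) {g : Inst m k n → Fin n → Bool} {Ψ : PathSp k m n}
    (hSV : StableValid g η ν Ψ) (hI : ¬ IndepBad g ν bp Ψ) : OgpBad k m n ν bm bp Ψ := by
  classical
  -- the data of the abstract extraction
  set x : ℕ → (Fin n → Bool) := fun t => g (instAt Ψ t) with hx
  set hpot : (ℕ → (Fin n → Bool)) → ℕ → (Fin n → Bool) → ℝ :=
    fun R ℓ v => condEnt (withRung R ℓ v) ℓ with hhpot
  -- Lipschitz step
  have hlip : ∀ (R : ℕ → Fin n → Bool) (ℓ t : ℕ), t < k * (m * k) →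
      |hpot R ℓ (x (t + 1)) - hpot R ℓ (x t)| ≤ Real.binEntropy η := by
    intro R ℓ t ht
    have hd := glue_dist_instAt_succ hSV ht
    rcases Nat.eq_zero_or_pos n with hn | hn
    · subst hn
      have : x (t + 1) = x t := funext fun i => i.elim0
      rw [this, sub_self, abs_zero]
      exact Real.binEntropy_nonneg hη (by linarith)
    have hnr : (0 : ℝ) < n := by exact_mod_cast hn
    have hdn : (hammingDist (x (t + 1)) (x t) : ℝ) / n ≤ η := by
      rw [div_le_iff₀ hnr, hammingDist_comm]; exact hd
    have hd2 : (hammingDist (x (t + 1)) (x t) : ℝ) ≤ n / 2 := by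
      rw [hammingDist_comm]
      calc (hammingDist (x t) (x (t + 1)) : ℝ) ≤ η * n := hd
        _ ≤ 1 / 2 * n := mul_le_mul_of_nonneg_right hη2 hnr.le
        _ = n / 2 := by ring
    calc |hpot R ℓ (x (t + 1)) - hpot R ℓ (x t)|
        ≤ Real.binEntropy ((hammingDist (x (t + 1)) (x t) : ℝ) / n) := hB.2 n ℓ R _ _ hd2
      _ ≤ Real.binEntropy η := by
          refine Real.binEntropy_strictMonoOn.monotoneOn ⟨by positivity, ?_⟩ ⟨hη, ?_⟩ hdn
          · exact hdn.trans (by linarith)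
          · linarith
  -- the jump one sweep later (`S_indep`)
  have hjump : ∀ (ℓ : ℕ) (ts : ℕ → ℕ) (t : ℕ), 1 ≤ ℓ → ℓ ≤ k → (∀ j < ℓ, ts j + m * k ≤ t) →
      t ≤ k * (m * k) → bp < hpot (fun j => x (ts j)) ℓ (x t) := by
    intro ℓ ts t _ hℓk hts ht
    by_contra hle
    push Not at hle
    apply hI
    refine ⟨⟨ℓ, Nat.lt_succ_of_le hℓk⟩, t, fun j => ts j, x t, ht, fun j => hts j j.isLt,
      glue_viol_instAt hSV hk ht, ?_⟩
    have hR : withRung (seqOf fun j : Fin ℓ => g (instAt Ψ (ts j))) ℓ (x t) =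
        withRung (fun j => x (ts j)) ℓ (x t) :=
      withRung_congr (fun j hj => by rw [seqOf_apply_lt _ hj]) _
    simpa [hhpot, hR] using hle
  -- run the extraction
  obtain ⟨ts, hts0, hgap, hrung⟩ := hA (Fin n → Bool) k (m * k) x hpot (Real.binEntropy η) bm bp
    hW hbm hwin (fun R R' ℓ v hRR' => condEnt_withRung_congr hRR' v)
    (fun R ℓ v hv => hB.1 n ℓ R v hv) hlip hjump
  -- times are bounded by `ℓ · (m k)`
  have hbound : ∀ ℓ ≤ k, ts ℓ ≤ ℓ * (m * k) := by
    intro ℓ hℓ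
    induction ℓ with
    | zero => simp [hts0]
    | succ ℓ ih =>
      calc ts (ℓ + 1) ≤ ts ℓ + m * k := (hgap ℓ (by omega)).2
        _ ≤ ℓ * (m * k) + m * k := Nat.add_le_add_right (ih (by omega)) _
        _ = (ℓ + 1) * (m * k) := by ring
  have hmono : ∀ i j, i ≤ j → j ≤ k → ts i ≤ ts j := by
    intro i j hij hjk
    induction j with
    | zero => simp [Nat.le_zero.1 hij]
    | succ j ih =>
      rcases Nat.lt_or_eq_of_le hij with h | h
      · exact (ih (Nat.lt_succ_iff.1 h) (by omega)).trans (hgap j (by omega)).1.le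
      · rw [h]
  refine ⟨fun ℓ => ts ℓ, fun ℓ => x (ts ℓ), ?_, ?_, ?_, ?_⟩
  · intro i j hij
    exact hmono i j hij (Nat.lt_succ_iff.1 j.isLt)
  · simpa using hbound k le_rfl
  · intro ℓ
    exact glue_viol_instAt hSV hk ((hbound ℓ (Nat.lt_succ_iff.1 ℓ.isLt)).trans
      (Nat.mul_le_mul_right _ (Nat.lt_succ_iff.1 ℓ.isLt)))
  · intro ℓ hℓ1
    have hℓk : (ℓ : ℕ) ≤ k := Nat.lt_succ_iff.1 ℓ.isLt
    have hmem := hrung ℓ hℓ1 hℓk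
    have hY : condEnt (seqOf fun ℓ' : Fin (k + 1) => x (ts ℓ')) ℓ =
        hpot (fun j => x (ts j)) ℓ (x (ts ℓ)) := by
      simp only [hhpot]
      refine condEnt_congr fun j hj => ?_
      rw [seqOf_apply_lt _ (by omega : j < k + 1)]
      rcases Nat.lt_or_eq_of_le hj with hj' | rfl
      · rw [withRung_of_lt _ _ _ hj']
      · rw [withRung_self]
    rw [hY]
    exact hmem

end Decomposition

/-! ## Glue, part 2: union bounds (first moments) -/

section Counting

open Finset
open scoped Classical

variable {k m n : ℕ}

/-- Union bound over a finite index type. -/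
theorem glue_card_filter_exists_le {α ι : Type*} [Fintype α] [Fintype ι] (P : ι → α → Prop)
    [∀ i, DecidablePred (P i)] [DecidablePred fun a => ∃ i, P i a] :
    ((univ.filter fun a => ∃ i, P i a).card : ℝ) ≤ ∑ i, ((univ.filter (P i)).card : ℝ) := by
  classical
  have hsub : (univ.filter fun a => ∃ i, P i a) ⊆ univ.biUnion fun i => univ.filter (P i) := by
    intro a ha
    simp only [mem_filter, mem_univ, true_and, mem_biUnion] at ha ⊢
    exact ha
  calc ((univ.filter fun a => ∃ i, P i a).card : ℝ)
      ≤ ((univ.biUnion fun i => univ.filter (P i)).card : ℝ) := by exact_mod_cast card_le_card hsub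
    _ ≤ ∑ i, ((univ.filter (P i)).card : ℝ) := by exact_mod_cast card_biUnion_le

/-- Monotonicity of a filtered count under implication. -/
theorem glue_card_filter_mono {α : Type*} [Fintype α] {P Q : α → Prop} [DecidablePred P]
    [DecidablePred Q] (h : ∀ a, P a → Q a) :
    ((univ.filter P).card : ℝ) ≤ ((univ.filter Q).card : ℝ) := by
  exact_mod_cast card_le_card fun a ha => by
    simp only [mem_filter, mem_univ, true_and] at ha ⊢; exact h a ha

/-- `violCount ≤ ν m` as an integer bound `≤ ⌊ν m⌋₊`. -/
theorem glue_viol_le_floor {ν : ℝ} {v m' : ℕ} (hν : 0 ≤ ν) (h : (v : ℝ) ≤ ν * m') :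
    v ≤ ⌊ν * (m' : ℝ)⌋₊ :=
  Nat.le_floor h

/-- **First moment for `S_indep`** (union over `ℓ ≤ k`, `t₀ ≤ T`, `ts : Fin ℓ → [0,T]`, then Stub F
with the candidate count of Stub C as `Bc`). -/
theorem glue_card_indepBad_le (hC : CondEntCount) (hF : IndepCount) (hn : 1 ≤ n)
    (g : Inst m k n → Fin n → Bool) {ν bp : ℝ} (hν : 0 ≤ ν) :
    ((univ.filter fun Ψ : PathSp k m n => IndepBad g ν bp Ψ).card : ℝ) ≤
      ((k : ℝ) + 1) * ((k * (m * k) : ℕ) + 1 : ℝ) ^ (k + 1) *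
        ((((n : ℝ) + 1) ^ (2 ^ k) * Real.exp (n * bp)) *
          (∑ j ∈ range (⌊ν * (m : ℝ)⌋₊ + 1), (m.choose j : ℝ)) *
          (1 - (1 / 2 : ℝ) ^ k) ^ (m - ⌊ν * (m : ℝ)⌋₊) * Fintype.card (PathSp k m n)) := by
  classical
  set T : ℕ := k * (m * k) with hT
  set J : ℕ := ⌊ν * (m : ℝ)⌋₊ with hJ
  set Bc : ℝ := ((n : ℝ) + 1) ^ (2 ^ k) * Real.exp (n * bp) with hBc
  set B : ℝ := Bc * (∑ j ∈ range (J + 1), (m.choose j : ℝ)) *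
    (1 - (1 / 2 : ℝ) ^ k) ^ (m - J) * Fintype.card (PathSp k m n) with hB
  -- the parametrised pieces
  set Q : (ℓ : Fin (k + 1)) → Fin (T + 1) → (Fin ℓ → Fin (T + 1)) → PathSp k m n → Prop :=
    fun ℓ t₀ ts Ψ => (∀ j, (ts j : ℕ) + m * k ≤ t₀) ∧ ∃ y : Fin n → Bool,
      violCount y (instAt Ψ t₀) ≤ J ∧
      condEnt (withRung (seqOf fun j : Fin ℓ => g (instAt Ψ (ts j))) ℓ y) ℓ ≤ bp with hQ
  have hB0 : 0 ≤ B := by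
    have : (0 : ℝ) ≤ 1 - (1 / 2 : ℝ) ^ k := by
      have : (1 / 2 : ℝ) ^ k ≤ 1 := pow_le_one₀ (by norm_num) (by norm_num)
      linarith
    positivity
  -- each piece is bounded by `B`
  have hpiece : ∀ (ℓ : Fin (k + 1)) (t₀ : Fin (T + 1)) (ts : Fin ℓ → Fin (T + 1)),
      ((univ.filter (Q ℓ t₀ ts)).card : ℝ) ≤ B := by
    intro ℓ t₀ ts
    by_cases hadm : ∀ j, (ts j : ℕ) + m * k ≤ t₀
    · have hBc' : ∀ R : ℕ → Fin n → Bool,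
          ((univ.filter fun y : Fin n → Bool => condEnt (withRung R ℓ y) ℓ ≤ bp).card : ℝ) ≤ Bc := by
        intro R
        refine (hC.1 n ℓ R bp).trans ?_
        refine mul_le_mul_of_nonneg_right ?_ (Real.exp_nonneg _)
        exact pow_le_pow_right₀ (by linarith) (Nat.pow_le_pow_right (by norm_num)
          (Nat.lt_succ_iff.1 ℓ.isLt))
      have h := hF k m n g ℓ t₀ (fun j => ts j) J bp Bc hn (Nat.lt_succ_iff.1 t₀.isLt) hadm hBc'
      refine le_trans (glue_card_filter_mono fun Ψ hΨ => hΨ.2) h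
    · have : univ.filter (Q ℓ t₀ ts) = ∅ := by
        refine filter_eq_empty_iff.2 fun Ψ _ hΨ => hadm hΨ.1
      rw [this, card_empty, Nat.cast_zero]
      exact hB0
  -- the event is covered by the pieces
  have hcover : ∀ Ψ : PathSp k m n, IndepBad g ν bp Ψ →
      ∃ ℓ : Fin (k + 1), ∃ t₀ : Fin (T + 1), ∃ ts : Fin ℓ → Fin (T + 1), Q ℓ t₀ ts Ψ := by
    rintro Ψ ⟨ℓ, t₀, ts, y, ht₀, hts, hviol, hent⟩
    refine ⟨ℓ, ⟨t₀, Nat.lt_succ_of_le ht₀⟩,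
      fun j => ⟨ts j, Nat.lt_succ_of_le ((Nat.le_add_right _ _).trans ((hts j).trans ht₀))⟩,
      fun j => hts j, y, glue_viol_le_floor hν hviol, hent⟩
  calc ((univ.filter fun Ψ : PathSp k m n => IndepBad g ν bp Ψ).card : ℝ)
      ≤ ((univ.filter fun Ψ => ∃ ℓ : Fin (k + 1), ∃ t₀ : Fin (T + 1),
          ∃ ts : Fin ℓ → Fin (T + 1), Q ℓ t₀ ts Ψ).card : ℝ) := glue_card_filter_mono hcover
    _ ≤ ∑ ℓ : Fin (k + 1), ((univ.filter fun Ψ => ∃ t₀ : Fin (T + 1),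
          ∃ ts : Fin ℓ → Fin (T + 1), Q ℓ t₀ ts Ψ).card : ℝ) := glue_card_filter_exists_le _
    _ ≤ ∑ ℓ : Fin (k + 1), ∑ t₀ : Fin (T + 1), ((univ.filter fun Ψ =>
          ∃ ts : Fin ℓ → Fin (T + 1), Q ℓ t₀ ts Ψ).card : ℝ) :=
        sum_le_sum fun ℓ _ => glue_card_filter_exists_le _
    _ ≤ ∑ ℓ : Fin (k + 1), ∑ t₀ : Fin (T + 1), ∑ ts : Fin ℓ → Fin (T + 1),
          ((univ.filter (Q ℓ t₀ ts)).card : ℝ) :=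
        sum_le_sum fun ℓ _ => sum_le_sum fun t₀ _ => glue_card_filter_exists_le _
    _ ≤ ∑ ℓ : Fin (k + 1), ∑ t₀ : Fin (T + 1), ∑ ts : Fin ℓ → Fin (T + 1), B :=
        sum_le_sum fun ℓ _ => sum_le_sum fun t₀ _ => sum_le_sum fun ts _ => hpiece ℓ t₀ ts
    _ = ∑ ℓ : Fin (k + 1), ((T : ℝ) + 1) * (((T : ℝ) + 1) ^ (ℓ : ℕ) * B) := by
        refine sum_congr rfl fun ℓ _ => ?_
        simp only [sum_const, card_univ, Fintype.card_fin, Fintype.card_fun, nsmul_eq_mul]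
        push_cast
        ring
    _ ≤ ∑ ℓ : Fin (k + 1), ((T : ℝ) + 1) * (((T : ℝ) + 1) ^ k * B) := by
        refine sum_le_sum fun ℓ _ => mul_le_mul_of_nonneg_left
          (mul_le_mul_of_nonneg_right (pow_le_pow_right₀ (by linarith) (Nat.lt_succ_iff.1 ℓ.isLt))
            hB0) (by positivity)
    _ = ((k : ℝ) + 1) * ((T : ℝ) + 1) ^ (k + 1) * B := by
        simp only [sum_const, card_univ, Fintype.card_fin, nsmul_eq_mul]
        push_cast
        ring

/-- **First moment for `S_ogp`** (union over time tuples and admissible ladders, then Stub E with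
the energy bound `D` supplied for every admissible ladder, and the tuple count of Stub C). -/
theorem glue_card_ogpBad_le (hC : CondEntCount) (hE : PathValidCount) (hn : 1 ≤ n)
    {ν bm bp D : ℝ} (hν : 0 ≤ ν) (hbp : 0 ≤ bp) (hD : 0 ≤ D)
    (hslots : 0 ≤ (m : ℝ) - (k + 1) * ⌊ν * (m : ℝ)⌋₊ - (k + 1))
    (hDY : ∀ Y : Fin (k + 1) → Fin n → Bool,
      (∀ ℓ : Fin (k + 1), 1 ≤ (ℓ : ℕ) → condEnt (seqOf Y) ℓ ∈ Set.Icc bm bp) →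
      D ≤ (energySum (seqOf Y) k : ℝ) / (n : ℝ) ^ k) :
    ((univ.filter fun Ψ : PathSp k m n => OgpBad k m n ν bm bp Ψ).card : ℝ) ≤
      ((k * (m * k) : ℕ) + 1 : ℝ) ^ (k + 1) *
        ((2 : ℝ) ^ n * (((n : ℝ) + 1) ^ (2 ^ k) * Real.exp (n * bp)) ^ k) *
        ((∑ j ∈ range ((k + 1) * ⌊ν * (m : ℝ)⌋₊ + 1), (m.choose j : ℝ)) *
          Real.exp (-((1 / 2 : ℝ) ^ k * D * ((m : ℝ) - (k + 1) * ⌊ν * (m : ℝ)⌋₊ - (k + 1)))) *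
          Fintype.card (PathSp k m n)) := by
  classical
  set T : ℕ := k * (m * k) with hT
  set J : ℕ := ⌊ν * (m : ℝ)⌋₊ with hJ
  set U : ℝ := (∑ j ∈ range ((k + 1) * J + 1), (m.choose j : ℝ)) *
    Real.exp (-((1 / 2 : ℝ) ^ k * D * ((m : ℝ) - (k + 1) * J - (k + 1)))) *
    Fintype.card (PathSp k m n) with hU
  set Adm : Finset (Fin (k + 1) → Fin n → Bool) := univ.filter fun Y =>
    ∀ ℓ : Fin (k + 1), 1 ≤ (ℓ : ℕ) → condEnt (seqOf Y) ℓ ∈ Set.Icc bm bp with hAdm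
  set R : (Fin (k + 1) → Fin (T + 1)) → (Fin (k + 1) → Fin n → Bool) → PathSp k m n → Prop :=
    fun ts Y Ψ => Y ∈ Adm ∧ ∀ ℓ, violCount (Y ℓ) (instAt Ψ (ts ℓ)) ≤ J with hR
  have hU0 : 0 ≤ U := by positivity
  -- each piece
  have hpiece : ∀ (ts : Fin (k + 1) → Fin (T + 1)) (Y : Fin (k + 1) → Fin n → Bool),
      ((univ.filter (R ts Y)).card : ℝ) ≤ (if Y ∈ Adm then U else 0) := by
    intro ts Y
    by_cases hY : Y ∈ Adm
    · rw [if_pos hY]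
      have hts : ∀ ℓ, ((ts ℓ : ℕ)) ≤ k * (m * k) := fun ℓ => Nat.lt_succ_iff.1 (ts ℓ).isLt
      have h := hE k m n (fun ℓ => ts ℓ) Y J hn hts
      refine le_trans (glue_card_filter_mono fun Ψ hΨ => hΨ.2) (h.trans ?_)
      refine mul_le_mul_of_nonneg_right (mul_le_mul_of_nonneg_left ?_ (by positivity))
        (by positivity)
      refine Real.exp_le_exp.2 (neg_le_neg ?_)
      have hY' : ∀ ℓ : Fin (k + 1), 1 ≤ (ℓ : ℕ) → condEnt (seqOf Y) ℓ ∈ Set.Icc bm bp := by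
        simpa [hAdm] using hY
      have := hDY Y hY'
      nlinarith [pow_nonneg (show (0:ℝ) ≤ 1 / 2 by norm_num) k, hslots, this, hD,
        mul_nonneg (pow_nonneg (show (0:ℝ) ≤ 1 / 2 by norm_num) k) hslots]
    · rw [if_neg hY]
      have : univ.filter (R ts Y) = ∅ := filter_eq_empty_iff.2 fun Ψ _ hΨ => hY hΨ.1
      rw [this, card_empty, Nat.cast_zero]
  -- cover
  have hcover : ∀ Ψ : PathSp k m n, OgpBad k m n ν bm bp Ψ →
      ∃ ts : Fin (k + 1) → Fin (T + 1), ∃ Y : Fin (k + 1) → Fin n → Bool, R ts Y Ψ := by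
    rintro Ψ ⟨ts, Y, hmono, hlast, hviol, hent⟩
    refine ⟨fun ℓ => ⟨ts ℓ, Nat.lt_succ_of_le ((hmono (Fin.le_last ℓ)).trans hlast)⟩, Y, ?_, ?_⟩
    · simpa [hAdm] using hent
    · intro ℓ
      exact glue_viol_le_floor hν (hviol ℓ)
  -- the admissible ladders
  have hAdmCard : (Adm.card : ℝ) ≤ (2 : ℝ) ^ n * (((n : ℝ) + 1) ^ (2 ^ k) * Real.exp (n * bp)) ^ k := by
    refine le_trans ?_ (hC.2 n k bp hbp)
    exact_mod_cast card_le_card fun Y hY => by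
      simp only [hAdm, mem_filter, mem_univ, true_and] at hY ⊢
      exact fun ℓ hℓ => (hY ℓ hℓ).2
  calc ((univ.filter fun Ψ : PathSp k m n => OgpBad k m n ν bm bp Ψ).card : ℝ)
      ≤ ((univ.filter fun Ψ => ∃ ts : Fin (k + 1) → Fin (T + 1),
          ∃ Y : Fin (k + 1) → Fin n → Bool, R ts Y Ψ).card : ℝ) := glue_card_filter_mono hcover
    _ ≤ ∑ ts : Fin (k + 1) → Fin (T + 1), ((univ.filter fun Ψ =>
          ∃ Y : Fin (k + 1) → Fin n → Bool, R ts Y Ψ).card : ℝ) := glue_card_filter_exists_le _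
    _ ≤ ∑ ts : Fin (k + 1) → Fin (T + 1), ∑ Y : Fin (k + 1) → Fin n → Bool,
          ((univ.filter (R ts Y)).card : ℝ) :=
        sum_le_sum fun ts _ => glue_card_filter_exists_le _
    _ ≤ ∑ ts : Fin (k + 1) → Fin (T + 1), ∑ Y : Fin (k + 1) → Fin n → Bool,
          (if Y ∈ Adm then U else 0) :=
        sum_le_sum fun ts _ => sum_le_sum fun Y _ => hpiece ts Y
    _ = ∑ ts : Fin (k + 1) → Fin (T + 1), (Adm.card : ℝ) * U := by
        refine sum_congr rfl fun ts _ => ?_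
        rw [← sum_filter, sum_const, nsmul_eq_mul]
        congr 2
        simp [hAdm]
    _ = ((T : ℝ) + 1) ^ (k + 1) * ((Adm.card : ℝ) * U) := by
        simp only [sum_const, card_univ, Fintype.card_fun, Fintype.card_fin, nsmul_eq_mul]
        push_cast
        ring
    _ ≤ ((T : ℝ) + 1) ^ (k + 1) *
          (((2 : ℝ) ^ n * (((n : ℝ) + 1) ^ (2 ^ k) * Real.exp (n * bp)) ^ k) * U) := by
        gcongr
    _ = ((k * (m * k) : ℕ) + 1 : ℝ) ^ (k + 1) *
        ((2 : ℝ) ^ n * (((n : ℝ) + 1) ^ (2 ^ k) * Real.exp (n * bp)) ^ k) *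
        ((∑ j ∈ range ((k + 1) * J + 1), (m.choose j : ℝ)) *
          Real.exp (-((1 / 2 : ℝ) ^ k * D * ((m : ℝ) - (k + 1) * J - (k + 1)))) *
          Fintype.card (PathSp k m n)) := by
        rw [hU, hT]; push_cast; ring

end Counting

/-! ## Glue, part 3a: fixed `k`, `n → ∞` -/

section FixedK

open Finset Filter Real
open scoped Classical Topology

variable {k m n : ℕ}

/-- Polynomials lose to exponentials, eventually in `n : ℕ`. -/
theorem glue_poly_le_exp_eventually (d : ℕ) (A a : ℝ) (ha : 0 < a) :
    ∀ᶠ n : ℕ in atTop, A * ((n : ℝ) + 2) ^ d ≤ Real.exp (a * n) := by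
  have h1 : (fun x : ℝ => x ^ d) =o[atTop] fun x => Real.exp (a / 2 * x) :=
    isLittleO_pow_exp_pos_mul_atTop d (half_pos ha)
  have h2 : Tendsto (fun n : ℕ => (n : ℝ) + 2) atTop atTop :=
    tendsto_atTop_add_const_right _ _ tendsto_natCast_atTop_atTop
  have h3 : ∀ᶠ n : ℕ in atTop, ((n : ℝ) + 2) ^ d ≤ Real.exp (a / 2 * ((n : ℝ) + 2)) := by
    have := (h1.comp_tendsto h2).eventuallyLE
    filter_upwards [this] with n hn
    simpa [Function.comp, abs_of_nonneg (by positivity : (0 : ℝ) ≤ (n : ℝ) + 2),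
      abs_of_pos (Real.exp_pos _)] using hn
  -- and `|A| e^{a} e^{(a/2) n} ≤ e^{a n}` eventually
  have h4 : ∀ᶠ n : ℕ in atTop, |A| * Real.exp a ≤ Real.exp (a / 2 * n) := by
    have ht : Tendsto (fun n : ℕ => Real.exp (a / 2 * n)) atTop atTop :=
      tendsto_exp_atTop.comp (Tendsto.const_mul_atTop (half_pos ha) tendsto_natCast_atTop_atTop)
    exact ht.eventually_ge_atTop _
  filter_upwards [h3, h4] with n h3 h4
  have hn0 : (0 : ℝ) ≤ ((n : ℝ) + 2) ^ d := by positivity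
  calc A * ((n : ℝ) + 2) ^ d ≤ |A| * ((n : ℝ) + 2) ^ d :=
        mul_le_mul_of_nonneg_right (le_abs_self A) hn0
    _ ≤ |A| * Real.exp (a / 2 * ((n : ℝ) + 2)) := mul_le_mul_of_nonneg_left h3 (abs_nonneg A)
    _ = |A| * Real.exp a * Real.exp (a / 2 * n) := by
        rw [show a / 2 * ((n : ℝ) + 2) = a + a / 2 * n by ring, Real.exp_add]; ring
    _ ≤ Real.exp (a / 2 * n) * Real.exp (a / 2 * n) :=
        mul_le_mul_of_nonneg_right h4 (Real.exp_nonneg _)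
    _ = Real.exp (a * n) := by rw [← Real.exp_add]; ring_nf

/-- `(1 - x)^N ≤ e^{-xN}` for `0 ≤ x ≤ 1`. -/
theorem glue_one_sub_pow_le {x : ℝ} (hx0 : 0 ≤ x) (hx1 : x ≤ 1) (N : ℕ) :
    (1 - x) ^ N ≤ Real.exp (-(x * N)) := by
  have h : 1 - x ≤ Real.exp (-x) := by linarith [Real.add_one_le_exp (-x)]
  calc (1 - x) ^ N ≤ (Real.exp (-x)) ^ N := pow_le_pow_left₀ (by linarith) h N
    _ = Real.exp (-(x * N)) := by rw [← Real.exp_nat_mul]; ring_nf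

/-- van Lint's bound in the form used here. -/
theorem glue_sum_choose_le (m' : ℕ) {l : ℝ} (h0 : 0 ≤ l) (h1 : l ≤ 1 / 2) {J' : ℕ}
    (hJ : J' ≤ ⌊l * m'⌋₊) :
    ∑ j ∈ range (J' + 1), (m'.choose j : ℝ) ≤ Real.exp (m' * binEntropy l) := by
  refine le_trans ?_ (Literature.Combinatorics.vanLint_sum_choose_le_exp_binEntropy m' h0 h1)
  exact sum_le_sum_of_subset_of_nonneg (range_subset_range.2 (by omega)) fun _ _ _ => by positivity

set_option maxHeartbeats 400000 in
/-- **The estimate for a fixed `k`** (all `k`-dependent inequalities as hypotheses; `n → ∞`). -/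
theorem glue_fixed_k (hA : LadderExtraction) (hB : EntropyToolkit) (hC : CondEntCount)
    (hE : PathValidCount) (hF : IndepCount) (hEn : EnergyBound) (hk : 2 ≤ k)
    {η ν bm bp θ L α : ℝ} (hη0 : 0 < η) (hη2 : η ≤ 1 / 2) (hν0 : 0 < ν)
    (hνk : ((k : ℝ) + 1) * ν ≤ 1 / 2) (hbm : 0 < bm) (hwin : binEntropy η ≤ bp - bm) (hθ0 : 0 < θ)
    (hθ1 : θ < 1) (hθb : 2 * θ ≤ bm) (hL : 0 < L) (hα : 0 < α)
    (hD0 : 0 ≤ (1 : ℝ) + k * (1 - (2 * (1 - (bm - 2 * θ) / (-Real.log θ)) ^ k +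
      k * ((bm - 2 * θ) / (-Real.log θ)) * (1 - (bm - 2 * θ) / (-Real.log θ)) ^ (k - 1))) -
      θ * ((k : ℝ) * (k + 1) / 2))
    (hI : bp + α * binEntropy ν - (1 / 2 : ℝ) ^ k * (1 - ν) * α ≤ -(2 * L))
    (hO : Real.log 2 + k * bp + α * binEntropy (((k : ℝ) + 1) * ν) -
      (1 / 2 : ℝ) ^ k * α * ((1 : ℝ) + k * (1 - (2 * (1 - (bm - 2 * θ) / (-Real.log θ)) ^ k +
      k * ((bm - 2 * θ) / (-Real.log θ)) * (1 - (bm - 2 * θ) / (-Real.log θ)) ^ (k - 1))) -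
      θ * ((k : ℝ) * (k + 1) / 2)) * (1 - ((k : ℝ) + 1) * ν) ≤ -(2 * L)) :
    ∀ᶠ n : ℕ in atTop, ∀ m : ℕ, m = ⌊α * n⌋₊ → ∀ g : Inst m k n → Fin n → Bool,
      ((univ.filter fun Ψ : PathSp k m n => StableValid g η ν Ψ).card : ℝ) ≤
        Real.exp (-(L / 2 * n)) * Fintype.card (PathSp k m n) := by
  -- abbreviations (made opaque: `clear_value`)
  set p₀ : ℝ := (bm - 2 * θ) / (-Real.log θ) with hp₀
  set D : ℝ := (1 : ℝ) + k * (1 - (2 * (1 - p₀) ^ k + k * p₀ * (1 - p₀) ^ (k - 1))) -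
    θ * ((k : ℝ) * (k + 1) / 2) with hD
  clear_value p₀ D
  have hk1 : 1 ≤ k := by omega
  have hν1 : ν ≤ 1 / 2 := by
    have hk0 : (0 : ℝ) ≤ k := Nat.cast_nonneg k
    nlinarith
  have hνk0 : 0 ≤ 1 - ((k : ℝ) + 1) * ν := by linarith
  have hbp : 0 ≤ bp := by linarith [binEntropy_nonneg hη0.le (by linarith : η ≤ 1)]
  have hhalf : (0 : ℝ) ≤ (1 / 2 : ℝ) ^ k := by positivity
  have hhalf1 : (1 / 2 : ℝ) ^ k ≤ 1 := pow_le_one₀ (by norm_num) (by norm_num)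
  -- polynomial prefactors
  obtain ⟨A₁, hA₁⟩ : ∃ A₁ : ℝ, A₁ = ((k : ℝ) + 1) * ((k : ℝ) ^ 2 * α + 1) ^ (k + 1) * Real.exp 1 :=
    ⟨_, rfl⟩
  obtain ⟨A₂, hA₂⟩ : ∃ A₂ : ℝ, A₂ = ((k : ℝ) ^ 2 * α + 1) ^ (k + 1) * Real.exp (D * (k + 2)) :=
    ⟨_, rfl⟩
  have ev1 := glue_poly_le_exp_eventually (k + 1 + 2 ^ k) A₁ L hL
  have ev2 := glue_poly_le_exp_eventually (k + 1 + k * 2 ^ k) A₂ L hL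
  -- `m` large
  have ev3 : ∀ᶠ n : ℕ in atTop, (2 * ((k : ℝ) + 1) + 2) ≤ α * n - 1 := by
    have ht : Tendsto (fun n : ℕ => α * n - 1) atTop atTop :=
      tendsto_atTop_add_const_right _ _ (Tendsto.const_mul_atTop hα tendsto_natCast_atTop_atTop)
    exact ht.eventually_ge_atTop _
  -- `2 e^{-L n} ≤ e^{-(L/2) n}`
  have ev4 : ∀ᶠ n : ℕ in atTop, Real.log 2 ≤ L / 2 * n := by
    have ht : Tendsto (fun n : ℕ => L / 2 * n) atTop atTop :=
      Tendsto.const_mul_atTop (half_pos hL) tendsto_natCast_atTop_atTop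
    exact ht.eventually_ge_atTop _
  filter_upwards [ev1, ev2, ev3, ev4] with n hn1 hn2 hn3 hn4 m hm g
  -- facts about `m`
  have hnn : (0 : ℝ) ≤ n := Nat.cast_nonneg n
  have hαn : 0 ≤ α * n := by positivity
  have hm_le : (m : ℝ) ≤ α * n := by rw [hm]; exact Nat.floor_le hαn
  have hm_ge : α * n - 1 ≤ m := by rw [hm]; exact (Nat.sub_one_lt_floor _).le
  have hm2 : 2 * ((k : ℝ) + 1) + 2 ≤ m := hn3.trans hm_ge
  have hk0 : (0 : ℝ) ≤ k := Nat.cast_nonneg k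
  have hm0 : (0 : ℝ) ≤ m := Nat.cast_nonneg m
  have hm1 : 1 ≤ m := by
    have : (1 : ℝ) ≤ m := by linarith
    exact_mod_cast this
  have hn1' : 1 ≤ n := by
    rcases Nat.eq_zero_or_pos n with hn0 | h
    · exfalso
      rw [hn0] at hn3
      simp only [Nat.cast_zero, mul_zero, zero_sub] at hn3
      linarith
    · exact h
  have hW : 0 < m * k := Nat.mul_pos (by omega) (by omega)
  have hJle : (⌊ν * (m : ℝ)⌋₊ : ℝ) ≤ ν * m := Nat.floor_le (by positivity)
  have hkJ : ((k : ℝ) + 1) * ⌊ν * (m : ℝ)⌋₊ ≤ (m : ℝ) / 2 := by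
    calc ((k : ℝ) + 1) * ⌊ν * (m : ℝ)⌋₊ ≤ ((k : ℝ) + 1) * (ν * m) :=
          mul_le_mul_of_nonneg_left hJle (by positivity)
      _ = (((k : ℝ) + 1) * ν) * m := by ring
      _ ≤ (1 / 2) * m := mul_le_mul_of_nonneg_right hνk hm0
      _ = m / 2 := by ring
  have hslots : 0 ≤ (m : ℝ) - (k + 1) * ⌊ν * (m : ℝ)⌋₊ - (k + 1) := by linarith
  -- (1) decomposition: `#SV ≤ #IB + #OB`
  have hdec : ((univ.filter fun Ψ : PathSp k m n => StableValid g η ν Ψ).card : ℝ) ≤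
      ((univ.filter fun Ψ : PathSp k m n => IndepBad g ν bp Ψ).card : ℝ) +
      ((univ.filter fun Ψ : PathSp k m n => OgpBad k m n ν bm bp Ψ).card : ℝ) := by
    have hsub : (univ.filter fun Ψ : PathSp k m n => StableValid g η ν Ψ) ⊆
        (univ.filter fun Ψ : PathSp k m n => IndepBad g ν bp Ψ) ∪
        (univ.filter fun Ψ : PathSp k m n => OgpBad k m n ν bm bp Ψ) := by
      intro Ψ hΨ
      simp only [mem_filter, mem_univ, true_and, mem_union] at hΨ ⊢
      by_cases hI : IndepBad g ν bp Ψ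
      · exact Or.inl hI
      · exact Or.inr (glue_ogpBad_of_stableValid hA hB hk1 hW hη0.le hη2 hbm.le hwin hΨ hI)
    calc ((univ.filter fun Ψ : PathSp k m n => StableValid g η ν Ψ).card : ℝ)
        ≤ (((univ.filter fun Ψ : PathSp k m n => IndepBad g ν bp Ψ) ∪
            (univ.filter fun Ψ : PathSp k m n => OgpBad k m n ν bm bp Ψ)).card : ℝ) := by
          exact_mod_cast card_le_card hsub
      _ ≤ _ := by exact_mod_cast card_union_le _ _
  -- (2) the energy bound for admissible ladders
  have hDY : ∀ Y : Fin (k + 1) → Fin n → Bool,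
      (∀ ℓ : Fin (k + 1), 1 ≤ (ℓ : ℕ) → condEnt (seqOf Y) ℓ ∈ Set.Icc bm bp) →
      D ≤ (energySum (seqOf Y) k : ℝ) / (n : ℝ) ^ k := by
    intro Y hY
    rw [hD]
    refine hEn n k (seqOf Y) θ bm p₀ hn1' hk1 hθ0 hθ1 hθb hp₀ fun ℓ hℓ1 hℓk => ?_
    have := hY ⟨ℓ, Nat.lt_succ_of_le hℓk⟩ hℓ1
    exact this.1
  -- (3) the two first moments
  have hIB := glue_card_indepBad_le (k := k) (m := m) hC hF hn1' g (bp := bp) hν0.le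
  have hOB := glue_card_ogpBad_le (k := k) (m := m) hC hE hn1' hν0.le hbp hD0 hslots hDY
  set J : ℕ := ⌊ν * (m : ℝ)⌋₊ with hJ
  clear_value J
  have hJm : J ≤ m := by
    have h : (J : ℝ) ≤ (m : ℝ) := by
      calc (J : ℝ) ≤ ν * m := hJle
        _ ≤ 1 * m := mul_le_mul_of_nonneg_right (by linarith) hm0
        _ = m := one_mul _
    exact_mod_cast h
  -- (4) the real-analysis bounds on the factors
  set P : ℝ := (Fintype.card (PathSp k m n) : ℝ) with hP
  clear_value P
  have hP0 : 0 ≤ P := by rw [hP]; positivity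
  have hTle : ((k * (m * k) : ℕ) + 1 : ℝ) ≤ ((k : ℝ) ^ 2 * α + 1) * ((n : ℝ) + 2) := by
    have h1 : ((k * (m * k) : ℕ) : ℝ) = (k : ℝ) ^ 2 * m := by push_cast; ring
    have h2 : (k : ℝ) ^ 2 * m ≤ (k : ℝ) ^ 2 * (α * n) :=
      mul_le_mul_of_nonneg_left hm_le (sq_nonneg _)
    have h3 : 0 ≤ (k : ℝ) ^ 2 * α := by positivity
    have h4 : ((k : ℝ) ^ 2 * α + 1) * ((n : ℝ) + 2) =
        (k : ℝ) ^ 2 * (α * n) + 2 * ((k : ℝ) ^ 2 * α) + n + 2 := by ring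
    rw [h1, h4]
    linarith
  have hT0 : (0 : ℝ) ≤ ((k * (m * k) : ℕ) + 1 : ℝ) := by positivity
  have hn12 : ((n : ℝ) + 1) ≤ (n : ℝ) + 2 := by linarith
  -- binomial sums
  have hN₁ : ∑ j ∈ range (J + 1), (m.choose j : ℝ) ≤ Real.exp (m * binEntropy ν) :=
    glue_sum_choose_le m hν0.le hν1 (by rw [hJ])
  have hN₂ : ∑ j ∈ range ((k + 1) * J + 1), (m.choose j : ℝ) ≤
      Real.exp (m * binEntropy (((k : ℝ) + 1) * ν)) := by
    refine glue_sum_choose_le m (by positivity) hνk (Nat.le_floor ?_)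
    push_cast
    rw [mul_assoc]
    exact mul_le_mul_of_nonneg_left hJle (by positivity)
  have hpowJ : (1 - (1 / 2 : ℝ) ^ k) ^ (m - J) ≤ Real.exp (-((1 / 2 : ℝ) ^ k * ((1 - ν) * m))) := by
    refine (glue_one_sub_pow_le hhalf hhalf1 (m - J)).trans (Real.exp_le_exp.2 (neg_le_neg ?_))
    refine mul_le_mul_of_nonneg_left ?_ hhalf
    rw [Nat.cast_sub hJm]
    linarith
  -- entropy terms: `m H ≤ α n H`
  have hH1 : (m : ℝ) * binEntropy ν ≤ α * n * binEntropy ν :=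
    mul_le_mul_of_nonneg_right hm_le (binEntropy_nonneg hν0.le (by linarith))
  have hH2 : (m : ℝ) * binEntropy (((k : ℝ) + 1) * ν) ≤ α * n * binEntropy (((k : ℝ) + 1) * ν) :=
    mul_le_mul_of_nonneg_right hm_le (binEntropy_nonneg (by positivity) (by linarith))
  -- (5) the `S_indep` total
  have hIBtot : ((univ.filter fun Ψ : PathSp k m n => IndepBad g ν bp Ψ).card : ℝ) ≤
      Real.exp (-(L * n)) * P := by
    refine hIB.trans ?_
    -- the four `n`-dependent factors
    have hF1 : ((n : ℝ) + 1) ^ (2 ^ k) ≤ ((n : ℝ) + 2) ^ (2 ^ k) :=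
      pow_le_pow_left₀ (by positivity) hn12 _
    have h4pos : 0 ≤ (1 - (1 / 2 : ℝ) ^ k) ^ (m - J) := pow_nonneg (by linarith) _
    have hprod : ((n : ℝ) + 1) ^ (2 ^ k) * Real.exp (n * bp) *
        (∑ j ∈ range (J + 1), (m.choose j : ℝ)) * (1 - (1 / 2 : ℝ) ^ k) ^ (m - J) ≤
        ((n : ℝ) + 2) ^ (2 ^ k) * Real.exp (n * bp) * Real.exp (m * binEntropy ν) *
          Real.exp (-((1 / 2 : ℝ) ^ k * ((1 - ν) * m))) := by
      have h12 : ((n : ℝ) + 1) ^ (2 ^ k) * Real.exp (n * bp) ≤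
          ((n : ℝ) + 2) ^ (2 ^ k) * Real.exp (n * bp) :=
        mul_le_mul_of_nonneg_right hF1 (Real.exp_nonneg _)
      have h123 := mul_le_mul h12 hN₁ (by positivity) (by positivity)
      exact mul_le_mul h123 hpowJ h4pos (by positivity)
    have hexp : Real.exp (n * bp) * Real.exp (m * binEntropy ν) *
        Real.exp (-((1 / 2 : ℝ) ^ k * ((1 - ν) * m))) ≤ Real.exp 1 * Real.exp (-(2 * L) * n) := by
      rw [← Real.exp_add, ← Real.exp_add, ← Real.exp_add]
      refine Real.exp_le_exp.2 ?_
      have h1 : (1 / 2 : ℝ) ^ k * ((1 - ν) * (α * n - 1)) ≤ (1 / 2 : ℝ) ^ k * ((1 - ν) * m) :=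
        mul_le_mul_of_nonneg_left (mul_le_mul_of_nonneg_left hm_ge (by linarith)) hhalf
      have h2 : (1 / 2 : ℝ) ^ k * (1 - ν) ≤ 1 := mul_le_one₀ hhalf1 (by linarith) (by linarith)
      have h3 := mul_le_mul_of_nonneg_right hI hnn
      linarith
    have hpre : ((k : ℝ) + 1) * ((k * (m * k) : ℕ) + 1 : ℝ) ^ (k + 1) * ((n : ℝ) + 2) ^ (2 ^ k) *
        Real.exp 1 ≤ A₁ * ((n : ℝ) + 2) ^ (k + 1 + 2 ^ k) := by
      have hT' : ((k * (m * k) : ℕ) + 1 : ℝ) ^ (k + 1) ≤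
          (((k : ℝ) ^ 2 * α + 1) * ((n : ℝ) + 2)) ^ (k + 1) := pow_le_pow_left₀ hT0 hTle _
      calc ((k : ℝ) + 1) * ((k * (m * k) : ℕ) + 1 : ℝ) ^ (k + 1) * ((n : ℝ) + 2) ^ (2 ^ k) *
            Real.exp 1
          ≤ ((k : ℝ) + 1) * (((k : ℝ) ^ 2 * α + 1) * ((n : ℝ) + 2)) ^ (k + 1) *
            ((n : ℝ) + 2) ^ (2 ^ k) * Real.exp 1 := by
            have := mul_le_mul_of_nonneg_left hT' (by positivity : (0 : ℝ) ≤ (k : ℝ) + 1)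
            exact mul_le_mul_of_nonneg_right (mul_le_mul_of_nonneg_right this (by positivity))
              (Real.exp_nonneg _)
        _ = A₁ * ((n : ℝ) + 2) ^ (k + 1 + 2 ^ k) := by rw [hA₁, mul_pow, pow_add]; ring
    calc ((k : ℝ) + 1) * ((k * (m * k) : ℕ) + 1 : ℝ) ^ (k + 1) *
          (((n : ℝ) + 1) ^ (2 ^ k) * Real.exp (n * bp) *
            (∑ j ∈ range (J + 1), (m.choose j : ℝ)) * (1 - (1 / 2 : ℝ) ^ k) ^ (m - J) * P)
        ≤ ((k : ℝ) + 1) * ((k * (m * k) : ℕ) + 1 : ℝ) ^ (k + 1) *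
          (((n : ℝ) + 2) ^ (2 ^ k) * (Real.exp 1 * Real.exp (-(2 * L) * n)) * P) := by
          refine mul_le_mul_of_nonneg_left ?_ (by positivity)
          refine mul_le_mul_of_nonneg_right ?_ hP0
          calc ((n : ℝ) + 1) ^ (2 ^ k) * Real.exp (n * bp) *
                (∑ j ∈ range (J + 1), (m.choose j : ℝ)) * (1 - (1 / 2 : ℝ) ^ k) ^ (m - J)
              ≤ ((n : ℝ) + 2) ^ (2 ^ k) * Real.exp (n * bp) * Real.exp (m * binEntropy ν) *
                Real.exp (-((1 / 2 : ℝ) ^ k * ((1 - ν) * m))) := hprod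
            _ = ((n : ℝ) + 2) ^ (2 ^ k) * (Real.exp (n * bp) * Real.exp (m * binEntropy ν) *
                Real.exp (-((1 / 2 : ℝ) ^ k * ((1 - ν) * m)))) := by ring
            _ ≤ ((n : ℝ) + 2) ^ (2 ^ k) * (Real.exp 1 * Real.exp (-(2 * L) * n)) :=
                mul_le_mul_of_nonneg_left hexp (by positivity)
      _ = ((k : ℝ) + 1) * ((k * (m * k) : ℕ) + 1 : ℝ) ^ (k + 1) * ((n : ℝ) + 2) ^ (2 ^ k) *
          Real.exp 1 * (Real.exp (-(2 * L) * n) * P) := by ring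
      _ ≤ A₁ * ((n : ℝ) + 2) ^ (k + 1 + 2 ^ k) * (Real.exp (-(2 * L) * n) * P) :=
          mul_le_mul_of_nonneg_right hpre (by positivity)
      _ ≤ Real.exp (L * n) * (Real.exp (-(2 * L) * n) * P) :=
          mul_le_mul_of_nonneg_right hn1 (by positivity)
      _ = Real.exp (-(L * n)) * P := by rw [← mul_assoc, ← Real.exp_add]; ring_nf
  -- (6) the `S_ogp` total (big sub-expressions made opaque)
  obtain ⟨Tf, hTf⟩ : ∃ x : ℝ, x = ((k * (m * k) : ℕ) + 1 : ℝ) ^ (k + 1) := ⟨_, rfl⟩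
  obtain ⟨F, hFd⟩ : ∃ x : ℝ, x = (2 : ℝ) ^ n * (((n : ℝ) + 1) ^ (2 ^ k) * Real.exp (n * bp)) ^ k :=
    ⟨_, rfl⟩
  obtain ⟨G, hGd⟩ : ∃ x : ℝ, x = (∑ j ∈ range ((k + 1) * J + 1), (m.choose j : ℝ)) *
      Real.exp (-((1 / 2 : ℝ) ^ k * D * ((m : ℝ) - (k + 1) * J - (k + 1)))) := ⟨_, rfl⟩
  obtain ⟨F', hF'd⟩ : ∃ x : ℝ, x = Real.exp (n * Real.log 2) *
      (((n : ℝ) + 2) ^ (k * 2 ^ k) * Real.exp (k * (n * bp))) := ⟨_, rfl⟩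
  obtain ⟨G', hG'd⟩ : ∃ x : ℝ, x = Real.exp (m * binEntropy (((k : ℝ) + 1) * ν)) *
      Real.exp (-((1 / 2 : ℝ) ^ k * D * ((1 - ((k : ℝ) + 1) * ν) * m - (k + 1)))) := ⟨_, rfl⟩
  have hOB' : ((univ.filter fun Ψ : PathSp k m n => OgpBad k m n ν bm bp Ψ).card : ℝ) ≤
      Tf * F * (G * P) := by rw [hTf, hFd, hGd]; exact hOB
  have hF0 : 0 ≤ F := by rw [hFd]; positivity
  have hG0 : 0 ≤ G := by rw [hGd]; positivity
  have hTf0 : 0 ≤ Tf := by rw [hTf]; positivity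
  have h2n : (2 : ℝ) ^ n = Real.exp (n * Real.log 2) := by
    rw [Real.exp_nat_mul, Real.exp_log two_pos]
  have hFF' : F ≤ F' := by
    rw [hFd, hF'd, h2n]
    refine mul_le_mul_of_nonneg_left ?_ (Real.exp_nonneg _)
    calc (((n : ℝ) + 1) ^ (2 ^ k) * Real.exp (n * bp)) ^ k
        ≤ (((n : ℝ) + 2) ^ (2 ^ k) * Real.exp (n * bp)) ^ k :=
          pow_le_pow_left₀ (by positivity)
            (mul_le_mul_of_nonneg_right (pow_le_pow_left₀ (by positivity) hn12 _)
              (Real.exp_nonneg _)) _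
      _ = ((n : ℝ) + 2) ^ (k * 2 ^ k) * Real.exp (k * (n * bp)) := by
          rw [mul_pow, ← Real.exp_nat_mul, pow_mul', ← pow_mul, mul_comm (2 ^ k) k]
  have hGG' : G ≤ G' := by
    rw [hGd, hG'd]
    refine mul_le_mul hN₂ (Real.exp_le_exp.2 (neg_le_neg ?_)) (Real.exp_nonneg _) (Real.exp_nonneg _)
    refine mul_le_mul_of_nonneg_left ?_ (mul_nonneg hhalf hD0)
    linarith [mul_le_mul_of_nonneg_left hJle (by positivity : (0 : ℝ) ≤ (k : ℝ) + 1)]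
  have hexp : F' * G' ≤ ((n : ℝ) + 2) ^ (k * 2 ^ k) * (Real.exp (D * (k + 2)) *
      Real.exp (-(2 * L) * n)) := by
    have hFG' : F' * G' = ((n : ℝ) + 2) ^ (k * 2 ^ k) * Real.exp (n * Real.log 2 + k * (n * bp) +
        (m * binEntropy (((k : ℝ) + 1) * ν) +
          -((1 / 2 : ℝ) ^ k * D * ((1 - ((k : ℝ) + 1) * ν) * m - (k + 1))))) := by
      rw [hF'd, hG'd, Real.exp_add, Real.exp_add, Real.exp_add]; ring
    rw [hFG', ← Real.exp_add]
    refine mul_le_mul_of_nonneg_left (Real.exp_le_exp.2 ?_) (by positivity)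
    have h1 : (1 / 2 : ℝ) ^ k * D * ((1 - ((k : ℝ) + 1) * ν) * (α * n - 1) - (k + 1)) ≤
        (1 / 2 : ℝ) ^ k * D * ((1 - ((k : ℝ) + 1) * ν) * m - (k + 1)) := by
      refine mul_le_mul_of_nonneg_left ?_ (mul_nonneg hhalf hD0)
      linarith [mul_le_mul_of_nonneg_left hm_ge hνk0]
    have h2 : (1 / 2 : ℝ) ^ k * D * ((1 - ((k : ℝ) + 1) * ν) + (k + 1)) ≤ D * (k + 2) := by
      have h21 : (1 / 2 : ℝ) ^ k * D ≤ D := mul_le_of_le_one_left hD0 hhalf1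
      have h22 : (1 - ((k : ℝ) + 1) * ν) + (k + 1) ≤ (k : ℝ) + 2 := by
        have : 0 ≤ ((k : ℝ) + 1) * ν := by positivity
        linarith
      calc (1 / 2 : ℝ) ^ k * D * ((1 - ((k : ℝ) + 1) * ν) + (k + 1))
          ≤ D * ((1 - ((k : ℝ) + 1) * ν) + (k + 1)) :=
            mul_le_mul_of_nonneg_right h21 (by linarith)
        _ ≤ D * ((k : ℝ) + 2) := mul_le_mul_of_nonneg_left h22 hD0
    have h3 := mul_le_mul_of_nonneg_right hO hnn
    linarith
  have hpre : Tf * ((n : ℝ) + 2) ^ (k * 2 ^ k) * Real.exp (D * (k + 2)) ≤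
      A₂ * ((n : ℝ) + 2) ^ (k + 1 + k * 2 ^ k) := by
    have hT' : Tf ≤ (((k : ℝ) ^ 2 * α + 1) * ((n : ℝ) + 2)) ^ (k + 1) := by
      rw [hTf]; exact pow_le_pow_left₀ hT0 hTle _
    calc Tf * ((n : ℝ) + 2) ^ (k * 2 ^ k) * Real.exp (D * (k + 2))
        ≤ (((k : ℝ) ^ 2 * α + 1) * ((n : ℝ) + 2)) ^ (k + 1) * ((n : ℝ) + 2) ^ (k * 2 ^ k) *
          Real.exp (D * (k + 2)) :=
          mul_le_mul_of_nonneg_right (mul_le_mul_of_nonneg_right hT' (by positivity))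
            (Real.exp_nonneg _)
      _ = A₂ * ((n : ℝ) + 2) ^ (k + 1 + k * 2 ^ k) := by rw [hA₂, mul_pow, pow_add]; ring
  have hOBtot : ((univ.filter fun Ψ : PathSp k m n => OgpBad k m n ν bm bp Ψ).card : ℝ) ≤
      Real.exp (-(L * n)) * P := by
    have hFG : F * G ≤ F' * G' := mul_le_mul hFF' hGG' hG0 (hF0.trans hFF')
    calc ((univ.filter fun Ψ : PathSp k m n => OgpBad k m n ν bm bp Ψ).card : ℝ)
        ≤ Tf * F * (G * P) := hOB'
      _ = Tf * (F * G) * P := by ring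
      _ ≤ Tf * (((n : ℝ) + 2) ^ (k * 2 ^ k) * (Real.exp (D * (k + 2)) *
          Real.exp (-(2 * L) * n))) * P :=
          mul_le_mul_of_nonneg_right (mul_le_mul_of_nonneg_left (hFG.trans hexp) hTf0) hP0
      _ = Tf * ((n : ℝ) + 2) ^ (k * 2 ^ k) * Real.exp (D * (k + 2)) *
          (Real.exp (-(2 * L) * n) * P) := by ring
      _ ≤ A₂ * ((n : ℝ) + 2) ^ (k + 1 + k * 2 ^ k) * (Real.exp (-(2 * L) * n) * P) :=
          mul_le_mul_of_nonneg_right hpre (by positivity)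
      _ ≤ Real.exp (L * n) * (Real.exp (-(2 * L) * n) * P) :=
          mul_le_mul_of_nonneg_right hn2 (by positivity)
      _ = Real.exp (-(L * n)) * P := by rw [← mul_assoc, ← Real.exp_add]; ring_nf
  -- (7) conclude
  have hfin : 2 * Real.exp (-(L * n)) ≤ Real.exp (-(L / 2 * n)) := by
    have h := mul_le_mul_of_nonneg_right (Real.exp_le_exp.2 hn4) (Real.exp_nonneg (-(L * n)))
    rw [Real.exp_log two_pos, ← Real.exp_add] at h
    have he : L / 2 * n + -(L * n) = -(L / 2 * n) := by ring
    rwa [he] at h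
  calc ((univ.filter fun Ψ : PathSp k m n => StableValid g η ν Ψ).card : ℝ)
      ≤ Real.exp (-(L * n)) * P + Real.exp (-(L * n)) * P := hdec.trans (add_le_add hIBtot hOBtot)
    _ = 2 * Real.exp (-(L * n)) * P := by ring
    _ ≤ Real.exp (-(L / 2 * n)) * P := mul_le_mul_of_nonneg_right hfin hP0


end FixedK

/-! ## Glue, part 3b: the `k`-dependent inequalities, eventually in `k` -/

section KAsymptotics

open Filter Real Finset
open scoped Topology

/-- The parameter conditions at `k`, for the parameters `η = 1/k²`, `ν = 4^{-k}`,
`bm = 2.6 log k/k`, `bp = 2.7 log k/k`, `θ = 1/(k log² k)`, rate `L = log k/k`,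
density `α = 5·2^k log k/k`. -/
def KACond (k : ℕ) : Prop :=
  2 ≤ k ∧ (1 / (k : ℝ) ^ 2 ≤ 1 / 2) ∧
  binEntropy (1 / (k : ℝ) ^ 2) ≤ 2.7 * (Real.log k / k) - 2.6 * (Real.log k / k) ∧
  ((k : ℝ) + 1) * (1 / 4 : ℝ) ^ k ≤ 1 / 2 ∧
  1 / ((k : ℝ) * (Real.log k) ^ 2) < 1 ∧
  2 * (1 / ((k : ℝ) * (Real.log k) ^ 2)) ≤ 2.6 * (Real.log k / k) ∧
  (0 ≤ (1 : ℝ) + k * (1 - (2 * (1 - (2.6 * (Real.log k / k) - 2 * (1 / ((k : ℝ) * (Real.log k) ^ 2))) /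
      (-Real.log (1 / ((k : ℝ) * (Real.log k) ^ 2)))) ^ k +
    k * ((2.6 * (Real.log k / k) - 2 * (1 / ((k : ℝ) * (Real.log k) ^ 2))) /
      (-Real.log (1 / ((k : ℝ) * (Real.log k) ^ 2)))) *
      (1 - (2.6 * (Real.log k / k) - 2 * (1 / ((k : ℝ) * (Real.log k) ^ 2))) /
        (-Real.log (1 / ((k : ℝ) * (Real.log k) ^ 2)))) ^ (k - 1))) -
    (1 / ((k : ℝ) * (Real.log k) ^ 2)) * ((k : ℝ) * (k + 1) / 2)) ∧
  (2.7 * (Real.log k / k) + (5 * 2 ^ k * Real.log k / k) * binEntropy ((1 / 4 : ℝ) ^ k) -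
    (1 / 2 : ℝ) ^ k * (1 - (1 / 4 : ℝ) ^ k) * (5 * 2 ^ k * Real.log k / k) ≤
    -(2 * (Real.log k / k))) ∧
  (Real.log 2 + k * (2.7 * (Real.log k / k)) +
    (5 * 2 ^ k * Real.log k / k) * binEntropy (((k : ℝ) + 1) * (1 / 4 : ℝ) ^ k) -
    (1 / 2 : ℝ) ^ k * (5 * 2 ^ k * Real.log k / k) *
      ((1 : ℝ) + k * (1 - (2 * (1 - (2.6 * (Real.log k / k) - 2 * (1 / ((k : ℝ) * (Real.log k) ^ 2))) /
        (-Real.log (1 / ((k : ℝ) * (Real.log k) ^ 2)))) ^ k +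
      k * ((2.6 * (Real.log k / k) - 2 * (1 / ((k : ℝ) * (Real.log k) ^ 2))) /
        (-Real.log (1 / ((k : ℝ) * (Real.log k) ^ 2)))) *
        (1 - (2.6 * (Real.log k / k) - 2 * (1 / ((k : ℝ) * (Real.log k) ^ 2))) /
          (-Real.log (1 / ((k : ℝ) * (Real.log k) ^ 2)))) ^ (k - 1))) -
      (1 / ((k : ℝ) * (Real.log k) ^ 2)) * ((k : ℝ) * (k + 1) / 2)) *
      (1 - ((k : ℝ) + 1) * (1 / 4 : ℝ) ^ k) ≤ -(2 * (Real.log k / k)))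

/-- `h₂(x) ≤ -x log x + x` for `0 < x < 1` (crude entropy bound). -/
theorem glue_binEntropy_le {x : ℝ} (hx0 : 0 < x) (hx1 : x < 1) :
    binEntropy x ≤ -(x * Real.log x) + x := by
  rw [binEntropy_eq_negMulLog_add_negMulLog_one_sub]
  have h1 : negMulLog x = -(x * Real.log x) := by simp [negMulLog]
  have h2 : negMulLog (1 - x) ≤ x := by
    have hy : 0 < 1 - x := by linarith
    have hlog : 1 - (1 - x)⁻¹ ≤ Real.log (1 - x) := Real.one_sub_inv_le_log_of_pos hy
    have : negMulLog (1 - x) = -((1 - x) * Real.log (1 - x)) := by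
      simp only [negMulLog]; ring
    rw [this]
    have hmul := mul_le_mul_of_nonneg_left hlog hy.le
    rw [mul_sub, mul_one, mul_inv_cancel₀ hy.ne'] at hmul
    linarith
  linarith

/-- `e^{2.5} ≥ 11.9`. -/
theorem glue_exp_two_pt_five : (11.9 : ℝ) ≤ Real.exp 2.5 := by
  have h1 : (2.7182818283 : ℝ) < Real.exp 1 := Real.exp_one_gt_d9
  have h2 : (1.625 : ℝ) ≤ Real.exp (1 / 2) := by
    have := Real.quadratic_le_exp_of_nonneg (show (0 : ℝ) ≤ 1 / 2 by norm_num)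
    norm_num at this ⊢
    linarith
  have he : Real.exp 2.5 = Real.exp 1 * Real.exp 1 * Real.exp (1 / 2) := by
    rw [← Real.exp_add, ← Real.exp_add]; norm_num
  rw [he]
  have h0 : (0 : ℝ) ≤ Real.exp 1 := Real.exp_nonneg 1
  nlinarith [mul_le_mul h1.le h1.le (by norm_num) h0, Real.exp_nonneg (1 / 2 : ℝ)]

/-- `log k ≥ 7` for `k ≥ 1200`. -/
theorem glue_log_ge_seven {k : ℕ} (hk : 1200 ≤ k) : (7 : ℝ) ≤ Real.log k := by
  have hk' : (1200 : ℝ) ≤ k := by exact_mod_cast hk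
  have he : Real.exp 7 ≤ 1200 := by
    have h1 : Real.exp 1 < 2.7182818286 := Real.exp_one_lt_d9
    have h7 : Real.exp 7 = (Real.exp 1) ^ 7 := by rw [← Real.exp_nat_mul]; norm_num
    rw [h7]
    calc (Real.exp 1) ^ 7 ≤ (2.7182818286 : ℝ) ^ 7 :=
          pow_le_pow_left₀ (Real.exp_nonneg 1) h1.le 7
      _ ≤ 1200 := by norm_num
  rw [Real.le_log_iff_exp_le (by linarith)]
  exact he.trans hk'

/-- `log 4 ≤ 2`. -/
theorem glue_log_four_le : Real.log 4 ≤ 2 := by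
  rw [Real.log_le_iff_le_exp (by norm_num)]
  have h1 : (2.7182818283 : ℝ) < Real.exp 1 := Real.exp_one_gt_d9
  have : Real.exp 2 = Real.exp 1 * Real.exp 1 := by rw [← Real.exp_add]; norm_num
  rw [this]
  nlinarith [Real.exp_nonneg (1 : ℝ)]

/-- The window parameter `s = k p₀ ∈ [2.5, 2.6]`. -/
theorem glue_KA_s {lg : ℝ} (hlg7 : 7 ≤ lg) (hL3 : 5 * Real.log lg ≤ 0.05 * lg) :
    2.5 ≤ (2.6 * lg - 2 * (1 / lg ^ 2)) / (lg + 2 * Real.log lg) ∧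
    (2.6 * lg - 2 * (1 / lg ^ 2)) / (lg + 2 * Real.log lg) ≤ 2.6 := by
  have hloglg : 0 ≤ Real.log lg := Real.log_nonneg (by linarith)
  have htpos : 0 < lg + 2 * Real.log lg := by linarith
  have hlg2 : (49 : ℝ) ≤ lg ^ 2 := by nlinarith
  have hθK : 1 / lg ^ 2 ≤ 1 / 49 := div_le_div_of_nonneg_left zero_le_one (by norm_num) hlg2
  have hθ0 : 0 ≤ 1 / lg ^ 2 := by positivity
  constructor
  · rw [le_div_iff₀ htpos]; nlinarith
  · rw [div_le_iff₀ htpos]; nlinarith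

/-- The binomial-extremality small ball at the window: `SB ≤ 0.39`. -/
theorem glue_KA_SB {k : ℕ} {K p₀ : ℝ} (hk1 : 1 ≤ k) (hK : K = k) (hs_le : K * p₀ ≤ 2.6)
    (hs_ge : 2.5 ≤ K * p₀) (hp0 : 0 ≤ p₀) (hp1 : p₀ ≤ 0.01) :
    2 * (1 - p₀) ^ k + K * p₀ * (1 - p₀) ^ (k - 1) ≤ 0.39 := by
  have hp₀lt : p₀ < 1 := by linarith
  have hpow : (1 - p₀) ^ k ≤ Real.exp (-(K * p₀)) := by
    have := glue_one_sub_pow_le hp0 hp₀lt.le k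
    rw [← hK, mul_comm] at this
    exact this
  have hexp : Real.exp (-(K * p₀)) ≤ Real.exp (-2.5) := Real.exp_le_exp.2 (by linarith)
  have he25 : Real.exp (-2.5) ≤ 1 / 11.9 := by
    rw [Real.exp_neg, one_div]
    exact inv_anti₀ (by norm_num) glue_exp_two_pt_five
  have hq : (1 - p₀) ^ k = (1 - p₀) ^ (k - 1) * (1 - p₀) := by
    rw [← pow_succ, Nat.sub_add_cancel hk1]
  have h1p : 0 < 1 - p₀ := by linarith
  have hpow1 : (1 - p₀) ^ (k - 1) ≤ Real.exp (-2.5) / (1 - p₀) := by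
    rw [le_div_iff₀ h1p, ← hq]; exact hpow.trans hexp
  have hpow1' : (1 - p₀) ^ (k - 1) ≤ (1 / 11.9) / 0.99 := by
    refine hpow1.trans ?_
    calc Real.exp (-2.5) / (1 - p₀) ≤ (1 / 11.9) / (1 - p₀) :=
          div_le_div_of_nonneg_right he25 h1p.le
      _ ≤ (1 / 11.9) / 0.99 := div_le_div_of_nonneg_left (by norm_num) (by norm_num) (by linarith)
  have hA : 2 * (1 - p₀) ^ k ≤ 2 * (1 / 11.9) := by linarith [hpow.trans (hexp.trans he25)]
  have hB : K * p₀ * (1 - p₀) ^ (k - 1) ≤ 2.6 * ((1 / 11.9) / 0.99) :=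
    mul_le_mul hs_le hpow1' (pow_nonneg h1p.le _) (by norm_num)
  have : 2 * (1 / 11.9 : ℝ) + 2.6 * ((1 / 11.9) / 0.99) ≤ 0.39 := by norm_num
  linarith

/-- Entropy of the validity slack: `h₂(c ν) ≤ c ν (k log 4 + 1)` for `ν = 4^{-k}`, `1 ≤ c`,
`c ν < 1`. -/
theorem glue_KA_binEnt {k : ℕ} {K c : ℝ} (hK : K = k) (hc : 1 ≤ c) (hcν : c * (1 / 4 : ℝ) ^ k < 1) :
    binEntropy (c * (1 / 4 : ℝ) ^ k) ≤ c * (1 / 4 : ℝ) ^ k * (K * Real.log 4 + 1) := by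
  have hν0 : (0 : ℝ) < (1 / 4 : ℝ) ^ k := by positivity
  have hw0 : 0 < c * (1 / 4 : ℝ) ^ k := by positivity
  have h := glue_binEntropy_le hw0 hcν
  have hlog : Real.log (c * (1 / 4 : ℝ) ^ k) = Real.log c - K * Real.log 4 := by
    rw [Real.log_mul (by positivity) hν0.ne', Real.log_pow, one_div, Real.log_inv, hK]; ring
  have hlogc : 0 ≤ Real.log c := Real.log_nonneg hc
  rw [hlog] at h
  have e : -(c * (1 / 4 : ℝ) ^ k * (Real.log c - K * Real.log 4)) + c * (1 / 4 : ℝ) ^ k =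
      c * (1 / 4 : ℝ) ^ k * (K * Real.log 4 + 1) - c * (1 / 4 : ℝ) ^ k * Real.log c := by ring
  rw [e] at h
  linarith [mul_nonneg hw0.le hlogc]

/-- The `α H(c ν)` terms are small: `α h₂(c ν) ≤ 10 c lg (K²/2^k)` (`α = 5·2^k lg/K`, `c ≤ 2K`). -/
theorem glue_KA_alphaH {k : ℕ} {K lg c : ℝ} (hK : K = k) (hK3 : 3 ≤ K) (hlg0 : 0 ≤ lg)
    (hc : 1 ≤ c) (hcK : c ≤ 2 * K) (hcν : c * (1 / 4 : ℝ) ^ k < 1) :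
    (5 * 2 ^ k * lg / K) * binEntropy (c * (1 / 4 : ℝ) ^ k) ≤ 10 * lg * (K ^ 3 / 2 ^ k) := by
  have hK0 : 0 < K := by linarith
  have h2k : (0 : ℝ) < (2 : ℝ) ^ k := by positivity
  have h14 : (2 : ℝ) ^ k * (1 / 4 : ℝ) ^ k = 1 / 2 ^ k := by
    rw [← mul_pow]; norm_num [div_pow]
  have hl4 : K * Real.log 4 + 1 ≤ K ^ 2 := by
    have := glue_log_four_le
    have hl40 : 0 ≤ Real.log 4 := Real.log_nonneg (by norm_num)
    nlinarith
  have hH := glue_KA_binEnt hK hc hcν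
  calc (5 * 2 ^ k * lg / K) * binEntropy (c * (1 / 4 : ℝ) ^ k)
      ≤ (5 * 2 ^ k * lg / K) * (c * (1 / 4 : ℝ) ^ k * (K * Real.log 4 + 1)) :=
        mul_le_mul_of_nonneg_left hH (by positivity)
    _ = 5 * lg * (c / K) * ((2 : ℝ) ^ k * (1 / 4 : ℝ) ^ k) * (K * Real.log 4 + 1) := by
        field_simp
    _ = 5 * lg * (c / K) * ((K * Real.log 4 + 1) / 2 ^ k) := by rw [h14]; ring
    _ ≤ 5 * lg * 2 * (K ^ 2 / 2 ^ k) := by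
        have h1 : (K * Real.log 4 + 1) / (2 : ℝ) ^ k ≤ K ^ 2 / 2 ^ k :=
          div_le_div_of_nonneg_right hl4 h2k.le
        have h2 : c / K ≤ 2 := by rw [div_le_iff₀ hK0]; linarith
        have h0 : 0 ≤ (K * Real.log 4 + 1) / (2 : ℝ) ^ k := by
          have : 0 ≤ Real.log 4 := Real.log_nonneg (by norm_num)
          positivity
        have h3 : 0 ≤ c / K := by positivity
        calc 5 * lg * (c / K) * ((K * Real.log 4 + 1) / 2 ^ k)
            ≤ 5 * lg * 2 * ((K * Real.log 4 + 1) / 2 ^ k) :=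
              mul_le_mul_of_nonneg_right (mul_le_mul_of_nonneg_left h2 (by positivity)) h0
          _ ≤ 5 * lg * 2 * (K ^ 2 / 2 ^ k) := mul_le_mul_of_nonneg_left h1 (by positivity)
    _ ≤ 5 * lg * 2 * (K ^ 3 / 2 ^ k) := by
        refine mul_le_mul_of_nonneg_left (div_le_div_of_nonneg_right ?_ h2k.le) (by positivity)
        nlinarith
    _ = 10 * lg * (K ^ 3 / 2 ^ k) := by ring

/-- **The `k`-asymptotics**: all parameter conditions hold for every large `k`. -/
theorem glue_KA : ∀ᶠ k : ℕ in atTop, KACond k := by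
  -- standard limits
  have L1 : Tendsto (fun k : ℕ => Real.log k / k) atTop (𝓝 0) := by
    have h := Real.tendsto_pow_log_div_mul_add_atTop 1 0 1 one_ne_zero
    have h' : Tendsto (fun x : ℝ => Real.log x / x) atTop (𝓝 0) := by
      simpa using h
    exact h'.comp tendsto_natCast_atTop_atTop
  have L2 : Tendsto (fun k : ℕ => (k : ℝ) ^ 4 / 2 ^ k) atTop (𝓝 0) :=
    tendsto_pow_const_div_const_pow_of_one_lt 4 one_lt_two
  have L3 : ∀ᶠ k : ℕ in atTop, 5 * Real.log (Real.log k) ≤ 0.05 * Real.log k := by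
    have hlo : ∀ᶠ x : ℝ in atTop, ‖Real.log x‖ ≤ 0.01 * ‖x‖ :=
      Real.isLittleO_log_id_atTop.bound (by norm_num)
    have ht : Tendsto (fun k : ℕ => Real.log k) atTop atTop :=
      Real.tendsto_log_atTop.comp tendsto_natCast_atTop_atTop
    have := ht.eventually hlo
    filter_upwards [this, eventually_ge_atTop 3] with k hk hk3
    have hk3' : (3 : ℝ) ≤ k := by exact_mod_cast hk3
    have hlogpos : 0 < Real.log k := Real.log_pos (by linarith)
    simp only [Real.norm_eq_abs, abs_of_pos hlogpos] at hk
    have := (le_abs_self _).trans hk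
    linarith
  have E1 := eventually_ge_atTop 1200
  have E2 : ∀ᶠ k : ℕ in atTop, (k : ℝ) ^ 4 / 2 ^ k ≤ 0.001 :=
    (L2.eventually (ge_mem_nhds (by norm_num : (0 : ℝ) < 0.001)))
  have E3 : ∀ᶠ k : ℕ in atTop, Real.log k / k ≤ 0.01 :=
    (L1.eventually (ge_mem_nhds (by norm_num : (0 : ℝ) < 0.01)))
  filter_upwards [E1, E2, E3, L3] with k hk hE4 hE3 hL3
  unfold KACond
  have hkr : (1200 : ℝ) ≤ k := by exact_mod_cast hk
  have hk1 : 1 ≤ k := by omega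
  have hlg7' : 7 ≤ Real.log k := glue_log_ge_seven hk
  refine ⟨by omega, ?_⟩
  -- make `K = ↑k` and `lg = log K` opaque
  set K : ℝ := (k : ℝ) with hK
  clear_value K
  have hK0 : (0 : ℝ) < K := by linarith only [hkr]
  have hK3 : (3 : ℝ) ≤ K := by linarith only [hkr]
  have hlgK' : Real.log K ≤ K - 1 := Real.log_le_sub_one_of_pos hK0
  have ht' : -Real.log (1 / (K * (Real.log K) ^ 2)) = Real.log K + 2 * Real.log (Real.log K) := by
    have hlgpos : 0 < Real.log K := by linarith only [hlg7']
    rw [one_div, Real.log_inv, neg_neg, Real.log_mul hK0.ne' (by positivity), Real.log_pow]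
    push_cast; ring
  set lg : ℝ := Real.log K with hlg
  clear_value lg
  have hlg0 : 0 < lg := by linarith only [hlg7']
  have hlgK : lg ≤ K := by linarith only [hlgK']
  have h2k : (0 : ℝ) < (2 : ℝ) ^ k := by positivity
  -- the small quantities
  have hE2 : K ^ 3 / 2 ^ k ≤ 0.001 :=
    le_trans (div_le_div_of_nonneg_right
      (pow_le_pow_right₀ (by linarith only [hkr]) (by norm_num : 3 ≤ 4)) h2k.le) hE4
  have hK3' : (1 : ℝ) ≤ K ^ 3 := one_le_pow₀ (by linarith only [hkr])
  have hinv2 : 1 / (2 : ℝ) ^ k ≤ 0.001 :=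
    (div_le_div_of_nonneg_right hK3' h2k.le).trans hE2
  have hK2small : K ^ 2 / 2 ^ k ≤ 0.001 := by
    refine le_trans (div_le_div_of_nonneg_right ?_ h2k.le) hE2
    nlinarith only [hkr]
  have hν : (1 / 4 : ℝ) ^ k ≤ 1 / 2 ^ k := by
    rw [div_pow, one_pow]
    exact div_le_div_of_nonneg_left zero_le_one h2k (pow_le_pow_left₀ (by norm_num) (by norm_num) k)
  have hν0 : (0 : ℝ) < (1 / 4 : ℝ) ^ k := by positivity
  have hνsmall : (1 / 4 : ℝ) ^ k ≤ 0.001 := hν.trans hinv2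
  have hw : (K + 1) * (1 / 4 : ℝ) ^ k ≤ 0.001 := by
    calc (K + 1) * (1 / 4 : ℝ) ^ k ≤ (K + 1) * (1 / 2 ^ k) :=
          mul_le_mul_of_nonneg_left hν (by linarith only [hkr])
      _ ≤ K ^ 2 * (1 / 2 ^ k) := mul_le_mul_of_nonneg_right (by nlinarith only [hkr]) (by positivity)
      _ = K ^ 2 / 2 ^ k := by ring
      _ ≤ 0.001 := hK2small
  -- `θ`
  have hKlg : 0 < K * lg ^ 2 := by positivity
  have hloglg : 0 ≤ Real.log lg := Real.log_nonneg (by linarith only [hlg7'])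
  have htpos : 0 < lg + 2 * Real.log lg := by linarith only [hlg0, hloglg]
  have hθlt : 1 / (K * lg ^ 2) < 1 := by
    rw [div_lt_one hKlg]; nlinarith only [hkr, hlg7']
  have hlg2 : (49 : ℝ) ≤ lg ^ 2 := by nlinarith only [hlg7']
  have hθK : 1 / lg ^ 2 ≤ 1 / 49 := div_le_div_of_nonneg_left zero_le_one (by norm_num) hlg2
  -- `s = K p₀ ∈ [2.5, 2.6]`, `p₀ ∈ [0, 0.01]`
  set p₀ : ℝ := (2.6 * (lg / K) - 2 * (1 / (K * lg ^ 2))) / (-Real.log (1 / (K * lg ^ 2))) with hp₀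
  clear_value p₀
  have hs : K * p₀ = (2.6 * lg - 2 * (1 / lg ^ 2)) / (lg + 2 * Real.log lg) := by
    rw [hp₀, ht']
    field_simp
  obtain ⟨hs_ge, hs_le⟩ : 2.5 ≤ K * p₀ ∧ K * p₀ ≤ 2.6 := by
    rw [hs]; exact glue_KA_s hlg7' hL3
  have hp₀0 : 0 ≤ p₀ := by
    by_contra h
    have : K * p₀ < 0 := mul_neg_of_pos_of_neg hK0 (lt_of_not_ge h)
    linarith only [this, hs_ge]
  have hp₀1 : p₀ ≤ 0.01 := by
    by_contra h
    have h' : 0.01 < p₀ := lt_of_not_ge h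
    have : K * 0.01 < K * p₀ := mul_lt_mul_of_pos_left h' hK0
    linarith only [this, hs_le, hkr]
  -- the small ball and `D`
  have hSB := glue_KA_SB hk1 hK hs_le hs_ge hp₀0 hp₀1
  set D : ℝ := (1 : ℝ) + K * (1 - (2 * (1 - p₀) ^ k + K * p₀ * (1 - p₀) ^ (k - 1))) -
    (1 / (K * lg ^ 2)) * (K * (K + 1) / 2) with hD
  clear_value D
  have hDge : 0.599 * K ≤ D := by
    have h1 : K * 0.61 ≤ K * (1 - (2 * (1 - p₀) ^ k + K * p₀ * (1 - p₀) ^ (k - 1))) :=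
      mul_le_mul_of_nonneg_left (by linarith only [hSB]) hK0.le
    have h2 : (1 / (K * lg ^ 2)) * (K * (K + 1) / 2) = (K + 1) / 2 * (1 / lg ^ 2) := by
      field_simp
    have h3 : (1 / (K * lg ^ 2)) * (K * (K + 1) / 2) ≤ (K + 1) / 2 * (1 / 49) := by
      rw [h2]; exact mul_le_mul_of_nonneg_left hθK (by linarith only [hkr])
    rw [hD]; linarith only [h1, h3, hkr]
  have hD0 : 0 ≤ D := by nlinarith only [hDge, hkr]
  -- `α H(ν) ≤ 10 lg K³/2^k`, `α H(w) ≤ 20 K lg K³/2^k`-type bounds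
  have hαHν : (5 * 2 ^ k * lg / K) * binEntropy ((1 / 4 : ℝ) ^ k) ≤ 0.01 * (lg / K) := by
    have hH := glue_KA_binEnt (c := 1) hK le_rfl (by rw [one_mul]; linarith only [hνsmall])
    have h14 : (2 : ℝ) ^ k * (1 / 4 : ℝ) ^ k = 1 / 2 ^ k := by
      rw [← mul_pow]; norm_num [div_pow]
    have hl4 : K * Real.log 4 + 1 ≤ K ^ 2 := by
      have := glue_log_four_le
      have hl40 : 0 ≤ Real.log 4 := Real.log_nonneg (by norm_num)
      nlinarith only [this, hl40, hkr]
    rw [one_mul] at hH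
    calc (5 * 2 ^ k * lg / K) * binEntropy ((1 / 4 : ℝ) ^ k)
        ≤ (5 * 2 ^ k * lg / K) * ((1 / 4 : ℝ) ^ k * (K * Real.log 4 + 1)) :=
          mul_le_mul_of_nonneg_left hH (by positivity)
      _ = 5 * (lg / K) * ((2 : ℝ) ^ k * (1 / 4 : ℝ) ^ k) * (K * Real.log 4 + 1) := by ring
      _ = 5 * (lg / K) * ((K * Real.log 4 + 1) / 2 ^ k) := by rw [h14]; ring
      _ ≤ 5 * (lg / K) * (K ^ 2 / 2 ^ k) :=
          mul_le_mul_of_nonneg_left (div_le_div_of_nonneg_right hl4 h2k.le) (by positivity)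
      _ ≤ 5 * (lg / K) * 0.001 := mul_le_mul_of_nonneg_left hK2small (by positivity)
      _ ≤ 0.01 * (lg / K) := by
          have : 0 ≤ lg / K := by positivity
          linarith only [this]
  have hαHw : (5 * 2 ^ k * lg / K) * binEntropy ((K + 1) * (1 / 4 : ℝ) ^ k) ≤ 0.05 := by
    have h := glue_KA_alphaH (c := K + 1) hK hK3 hlg0.le (by linarith only [hkr])
      (by linarith only [hkr]) (by linarith only [hw])
    have h' : 10 * lg * (K ^ 3 / 2 ^ k) ≤ 10 * K * (K ^ 3 / 2 ^ k) :=
      mul_le_mul_of_nonneg_right (by linarith only [hlgK]) (by positivity)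
    have h'' : 10 * K * (K ^ 3 / 2 ^ k) = 10 * (K ^ 4 / 2 ^ k) := by ring
    linarith only [h, h', h'', hE4]
  -- (c3)
  have hc3 : binEntropy (1 / K ^ 2) ≤ 2.7 * (lg / K) - 2.6 * (lg / K) := by
    have hx0 : (0 : ℝ) < 1 / K ^ 2 := by positivity
    have hx1 : 1 / K ^ 2 < 1 := by
      rw [div_lt_one (by positivity)]; nlinarith only [hkr]
    have h := glue_binEntropy_le hx0 hx1
    have hlogx : Real.log (1 / K ^ 2) = -(2 * lg) := by
      rw [one_div, Real.log_inv, Real.log_pow, hlg]; ring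
    rw [hlogx] at h
    have hkey : 1 / K ^ 2 * (2 * lg) + 1 / K ^ 2 ≤ 0.1 * (lg / K) := by
      rw [show 1 / K ^ 2 * (2 * lg) + 1 / K ^ 2 = (2 * (lg / K) + 1 / K) * (1 / K) by
        field_simp]
      rw [show 0.1 * (lg / K) = (0.1 * lg) * (1 / K) by ring]
      refine mul_le_mul_of_nonneg_right ?_ (by positivity)
      have : 1 / K ≤ 1 / 1200 := div_le_div_of_nonneg_left zero_le_one (by norm_num) hkr
      linarith only [this, hE3, hlg7']
    have e : -(1 / K ^ 2 * -(2 * lg)) + 1 / K ^ 2 = 1 / K ^ 2 * (2 * lg) + 1 / K ^ 2 := by ring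
    rw [e] at h
    linarith only [h, hkey]
  have hlgK0 : 0 < lg / K := div_pos hlg0 hK0
  -- assemble
  refine ⟨?_, hc3, by linarith only [hw], hθlt, ?_, hD0, ?_, ?_⟩
  · -- `1/K² ≤ 1/2`
    rw [div_le_div_iff₀ (by positivity) (by norm_num)]; nlinarith only [hkr]
  · -- `2θ ≤ 2.6 lg/K`
    rw [show 2 * (1 / (K * lg ^ 2)) = (2 / lg ^ 2) * (1 / K) by field_simp,
      show 2.6 * (lg / K) = (2.6 * lg) * (1 / K) by ring]
    refine mul_le_mul_of_nonneg_right ?_ (by positivity)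
    rw [div_le_iff₀ (by positivity)]; nlinarith only [hlg7']
  · -- (c8) the `S_indep` exponent
    have hhalf : (1 / 2 : ℝ) ^ k * (1 - (1 / 4 : ℝ) ^ k) * (5 * 2 ^ k * lg / K) =
        5 * (lg / K) * (1 - (1 / 4 : ℝ) ^ k) := by
      have : (1 / 2 : ℝ) ^ k * (2 : ℝ) ^ k = 1 := by rw [← mul_pow]; norm_num
      calc (1 / 2 : ℝ) ^ k * (1 - (1 / 4 : ℝ) ^ k) * (5 * 2 ^ k * lg / K)
          = ((1 / 2 : ℝ) ^ k * (2 : ℝ) ^ k) * (5 * (lg / K) * (1 - (1 / 4 : ℝ) ^ k)) := by ring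
        _ = 5 * (lg / K) * (1 - (1 / 4 : ℝ) ^ k) := by rw [this, one_mul]
    rw [hhalf]
    have hx := mul_le_mul_of_nonneg_left hνsmall hlgK0.le
    linarith only [hαHν, hx, hlgK0]
  · -- (c9) the `S_ogp` exponent
    have hhalf : (1 / 2 : ℝ) ^ k * (5 * 2 ^ k * lg / K) = 5 * (lg / K) := by
      have : (1 / 2 : ℝ) ^ k * (2 : ℝ) ^ k = 1 := by rw [← mul_pow]; norm_num
      calc (1 / 2 : ℝ) ^ k * (5 * 2 ^ k * lg / K)
          = ((1 / 2 : ℝ) ^ k * (2 : ℝ) ^ k) * (5 * (lg / K)) := by ring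
        _ = 5 * (lg / K) := by rw [this, one_mul]
    rw [hhalf]
    have hlog2 : Real.log 2 < 0.6931471808 := Real.log_two_lt_d9
    have hmainterm : 2.965 * lg ≤ 5 * (lg / K) * D * (1 - (K + 1) * (1 / 4 : ℝ) ^ k) := by
      have hw' : 0.99 ≤ 1 - (K + 1) * (1 / 4 : ℝ) ^ k := by linarith only [hw]
      have h1 : 5 * (lg / K) * (0.599 * K) * 0.99 ≤
          5 * (lg / K) * D * (1 - (K + 1) * (1 / 4 : ℝ) ^ k) :=
        mul_le_mul (mul_le_mul_of_nonneg_left hDge (by positivity)) hw' (by norm_num)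
          (by positivity)
      have h2 : 5 * (lg / K) * (0.599 * K) * 0.99 = 2.96505 * lg := by field_simp; ring
      linarith only [h1, h2, hlg0]
    have e : K * (2.7 * (lg / K)) = 2.7 * lg := by field_simp
    rw [e]
    have hx : 2 * (lg / K) ≤ 0.02 := by linarith only [hE3]
    linarith only [hmainterm, hαHw, hlog2, hx, hlg7']


end KAsymptotics

/-! ## Glue, part 3c: assembly of the crux -/

section Assembly

open Filter Real Finset
open scoped Classical Topology

/-- **The glue**: the six stubs imply the crux. -/
theorem glue_noStableSection (hA : LadderExtraction) (hB : EntropyToolkit) (hC : CondEntCount)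
    (hE : PathValidCount) (hF : IndepCount) (hEn : EnergyBound) :
    Summit.PneNP.PneNP.Theses.OverlapGapAlgebra.NoStableSection := by
  obtain ⟨k₀, hk₀⟩ := Filter.eventually_atTop.1 glue_KA
  refine ⟨k₀, fun k hk => ?_⟩
  obtain ⟨h2k, hη2, hwin, hνk, hθ1, hθb, hD0, hI, hO⟩ := hk₀ k hk
  have hkr : (2 : ℝ) ≤ k := by exact_mod_cast h2k
  have hkpos : (0 : ℝ) < k := by linarith
  have hlogk : 0 < Real.log k := Real.log_pos (by linarith)
  have hLr : 0 < Real.log k / k := div_pos hlogk hkpos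
  have hη0 : (0 : ℝ) < 1 / (k : ℝ) ^ 2 := by positivity
  have hν0 : (0 : ℝ) < (1 / 4 : ℝ) ^ k := by positivity
  have hθ0 : (0 : ℝ) < 1 / ((k : ℝ) * (Real.log k) ^ 2) := by positivity
  have hbm : (0 : ℝ) < 2.6 * (Real.log k / k) := by positivity
  have hα : (0 : ℝ) < 5 * 2 ^ k * Real.log k / k := by positivity
  refine ⟨1 / (k : ℝ) ^ 2, hη0, (1 / 4 : ℝ) ^ k, hν0, Real.log k / k / 2, half_pos hLr, ?_⟩
  have hmain := glue_fixed_k (k := k) hA hB hC hE hF hEn h2k hη0 hη2 hν0 hνk hbm hwin hθ0 hθ1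
    hθb hLr hα hD0 hI hO
  filter_upwards [hmain] with n hn m hm g
  convert hn m hm g using 3
  ext Ψ
  simp only [Finset.mem_filter, Finset.mem_univ, true_and]
  exact Iff.rfl

end Assembly

/-- Stub G (lead). Size L. Leans on: all of the above, `Nat.floor` API, `isLittleO_pow_exp_pos_mul_atTop`,
`Literature.Combinatorics.vanLint_sum_choose_le_exp_binEntropy`, `Real.add_one_le_exp`. -/
theorem stub_glue : Glue :=
  fun hA hB hC hE hF hEn => glue_noStableSection hA hB hC hE hF hEn

/-! ## Name-keyed aliases of the stub statements (hypotheses of the composition) -/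
namespace Registered

/-- Alias of `LadderExtraction` keyed by the registered stub name. -/
abbrev stub_ladderExtraction : Prop := LadderExtraction
/-- Alias of `EntropyToolkit` keyed by the registered stub name. -/
abbrev stub_entropyToolkit : Prop := EntropyToolkit
/-- Alias of `CondEntCount` keyed by the registered stub name. -/
abbrev stub_condEntCount : Prop := CondEntCount
/-- Alias of `PathValidCount` keyed by the registered stub name. -/
abbrev stub_pathValidCount : Prop := PathValidCount
/-- Alias of `IndepCount` keyed by the registered stub name. -/
abbrev stub_indepCount : Prop := IndepCount
/-- Alias of `EnergyBound` keyed by the registered stub name. -/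
abbrev stub_energyBound : Prop := EnergyBound
/-- Alias of `Glue` keyed by the registered stub name. -/
abbrev stub_glue : Prop := Glue

end Registered

/-! ## The composition -/

/-- **`NoStableSection` from the seven stubs** (concludes the crux BY NAME). -/
theorem NoStableSection_of (hA : Registered.stub_ladderExtraction) (hB : Registered.stub_entropyToolkit)
    (hC : Registered.stub_condEntCount) (hE : Registered.stub_pathValidCount)
    (hF : Registered.stub_indepCount) (hEn : Registered.stub_energyBound)
    (hG : Registered.stub_glue) :
    Summit.PneNP.PneNP.Theses.OverlapGapAlgebra.NoStableSection :=
  hG hA hB hC hE hF hEn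

/-- Wiring check: the registered stubs feed `NoStableSection_of` as stated. -/
example : Summit.PneNP.PneNP.Theses.OverlapGapAlgebra.NoStableSection :=
  NoStableSection_of stub_ladderExtraction stub_entropyToolkit stub_condEntCount stub_pathValidCount
    stub_indepCount stub_energyBound stub_glue

/-- Sanity: the crux's event is `StableValid` with `P = splice Ψ` (definitional unfolding). -/
example (k m n : ℕ) (η ν : ℝ) (g : Inst m k n → Fin n → Bool) (Ψ : PathSp k m n) :
    StableValid g η ν Ψ ↔
      (let P : Fin k → ℕ → Fin m → Fin k → Fin n × Bool := fun r q a b =>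
        if (a : ℕ) * k + b < q then Ψ r.succ a b else Ψ r.castSucc a b
      (∀ r : Fin k, ∀ q ≤ m * k, ((Finset.univ.filter fun i : Fin m =>
          ∀ j, g (P r q) (P r q i j).1 ≠ (P r q i j).2).card : ℝ) ≤ ν * m) ∧
        ∀ r : Fin k, ∀ q < m * k, (hammingDist (g (P r q)) (g (P r (q + 1))) : ℝ) ≤ η * n) :=
  Iff.rfl

end Summit.PneNP.PneNP.Cruxes.NoStableSection.DartGame
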